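import Mathlib
import Literature.MathematicalPhysics.QuantumFieldTheory.Balaban1983to89.B13ExpansionOrder
import Literature.MathematicalPhysics.QuantumFieldTheory.Balaban1983to89.B13Ineq140
import Literature.MathematicalPhysics.QuantumFieldTheory.Balaban1983to89.B13Contraction113
import Literature.MathematicalPhysics.QuantumFieldTheory.Balaban1983to89.B2

/-!
# `Balaban1983to89.B13GaugeDevices` — [II] Lemma 2, last clause: the localisation DEVICES of Sects. 1–2 of
# [Balaban1988RG2Cluster] commute with the simultaneous gauge transformations (I.3.29); KERNEL-CHECKED device algebra

Paper sub-cell B13 of the Bałaban programme audit (cell `pub-balaban`), generations 17–19.  Companion record: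
`b2b-balaban-b13/G-B13-06-devices.md` (device census D1–D11 with the printed loci), GAPS G-B13-06 / C-B13-36 / C-B13-42.
VALUE = kernel bookkeeping certificate for the sentence *«the operations in this section preserve the gauge
invariance»* ([II] p. 11): every device used in Sects. 1–2 of [II] is an instance of one of the closure lemmas below,
which hold over ABSTRACT carriers (a type of configurations `𝔘` with the map `U ↦ U^u` an arbitrary self-map `g`, a
space of fields `Φ` with `R(u)` an arbitrary (linear / isometric / homogeneous, as stated) self-map `ρ`); NOT summit
progress; NO disputed step of the papers under audit is certified.  In particular the TRANSFORMATION LAWS of the basic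
operators ((3.28)–(3.34) of [13], and their analogues for the operators of [I], [15]) and the existence / uniqueness of
the solutions of the local equations (1.3)–(1.5), (1.12)–(1.16) enter as HYPOTHESES (`Cov …`, `huniq`), exactly as
the print uses them (*«e.g. see (3.28)–(3.34) [13]»*, p. 21).

statement-level skeleton of published theorems with citation tags; proofs where landed; nothing here is a claim about the Yang–Mills mass gap

CITATION HEADER (lean-in-tree rule 2026-08-18).  Sources (held; quotations READ AS IMAGES from the renders
`b2b-balaban-ref1/pages/1988-cmp116-rg-II-cluster/1988-cmp116-rg-II-cluster-p011-x2.png`, `…-p021-x2.png`,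
`…-p022-x2.png`, for §G (v1.2) `…-p005-x2.png`, and for §H (v1.3) `…-p012-x2.png`, `…-p013-x2.png`;
`…/1987-cmp109-rg-I-small-field/1987-cmp109-rg-I-small-field-p028-x2.png` (journal p. 276);
`…/1985-cmp99-background-propagators/1985-cmp99-background-propagators-p007-x2.png`, `…-p008-x2.png` (journal
pp. 395–396); [II]'s reference list is *«1. [I] … and references therein»*, so `[13]`, `[15]` are [I]'s numbers):
* [Balaban1988RG2Cluster] = B13 = [II], Commun. Math. Phys. **116** (1988) 1–22 (`paper:balaban1988-cmp116-rg-ii-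
  cluster`): p. 11, Lemma 2 *«The functions V_k(Y, U, J, B), and both terms in (1.42), are gauge invariant with
  respect to the simultaneous gauge transformations (I.3.29), for Gᶜ-valued transformations u in a sufficiently small
  neighborhood of all G-valued transformations.»* and *«Let us remark that the last statement is a simple consequence
  of the statement in Sect. I.3, in the paragraph containing (I.3.29), and of the fact that the operations in this
  section preserve the gauge invariance.»*; p. 11 (Sect. 2) *«Let us suppress the dependence on the external gauge
  fields in the formulas below.»*; pp. 21–22 *«Let us make a last remark about the expressions (2.14). By Lemma 2, and
  the transformation properties of the operators in (2.14) with respect to gauge transformations, e.g. see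
  (3.28)–(3.34) [13], the expressions (2.14) are gauge invariant with respect to all G-valued transformations. The
  expressions are analytic functions of (U, J), hence the invariance can be extended, by the analyticity, to Gᶜ-valued
  gauge transformations in a small neighborhood of the space of G-valued ones.»*
* [Balaban1987RG1] = B12 = [I], Commun. Math. Phys. **109** (1987) 249–301: p. 276 *«The functions (3.25), (3.26)
  are gauge invariant with respect to the simultaneous gauge transformations U → Uᵘ, J → R(u)J, B → R(u)B, (3.29)
  for Gᶜ-valued transformations u in a sufficiently small neighborhood of G-valued transformations, so that the
  configurations after the transformations belong to proper spaces also.»*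
* [Balaban1985BackgroundPropagators] = B9 = [13], Commun. Math. Phys. **99** (1985) 389–434: p. 395 *«Δ_a↾Ω₀ =
  Ω₀Δ_aΩ₀, and we denote its inverse again by G»* (3.27); (3.28) *«U → Uᵘ, U′ → R(u)U′, where Uᵘ(x, x′) =
  u(x)U(x, x′)u⁻¹(x′), (R(u)U′)(x, x′) = R(u(x))U′(x, x′)»*; *«Of course R(u(x)) exp iηA(x, x′) = exp iηR(u(x))A(x, x′)
  and R(u)A is linear in A, hence expanding both sides of the above equality in A we get a sequence of equalities
  between homogeneous polynomials of the same order. Taking the polynomials of first and second order we get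
  ⟨R(u)A, Jᵘ⟩ = ⟨A, J⟩, ⟨R(u)A, Δ^η(Uᵘ)R(u)A⟩ = ⟨A, Δ^η(U)A⟩, (3.30) or Jᵘ = R(u)J, Δ^η(Uᵘ) = R(u)Δ^η(U)R(u⁻¹).»*;
  (3.31) *«⟨R(u)λ, Δ^η_{Uᵘ}R(u)λ⟩ = ⟨λ, Δ^η_Uλ⟩, hence Δ^η_{Uᵘ} = R(u)Δ^η_UR(u⁻¹)»*; p. 396 (3.33)–(3.34)
  *«G′(Uᵘ) = R(u)G′(U)R(u⁻¹), R(Uᵘ) = R(u)R(U)R(u⁻¹)»*, *«Δ_a(Uᵘ) = R(u)Δ_a(U)R(u⁻¹), G(Uᵘ) = R(u)G(U)R(u⁻¹)»*.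

* (v1.3, §H) [II] pp. 12–13, (2.5)–(2.6): quoted in full in the §H section docstring below; their printed model *«(2.28)
  [6]»* is [Balaban1982Higgs2] = B2, Commun. Math. Phys. **86** (1982), (2.28) p. 563, quoted and typed IN-TREE in `B2`
  (`B2.Display228`; the completed square `B2.completeSquare228` KERNEL-CHECKED there) — imported, not re-read here.

THE MODEL.  `𝔘` = a type of external configurations `(U, J)` (or `(U, J, …)`), `g : 𝔘 → 𝔘` = the map of ONE fixed
transformation `u` on them — a SELF-map: the proviso *«so that the configurations after the transformations belong to
proper spaces also»* ([I] p. 276) is, on the configuration side, the hypothesis that `u` maps the space of admissible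
configurations into itself (C-adv2-71 R3; its field-variable side — the domains `|A′| < ε₂`, `|X| < 4C₂ε₂²` — is §G); `Φ` = the space of the linearly-acting variable (`B`, `B′`, `A`, `λ`, `X`), `ρ : Φ → Φ`
= `R(u)` on it.  `Inv g ρ f` (*«gauge invariant with respect to the simultaneous transformations»*) and `Cov g ρ T`
(*«T(Uᵘ) = R(u)T(U)R(u⁻¹)»*) are the two printed shapes.  Lattice fields are `ι → V` with `R(u)` acting fibrewise
(`fibrewise r`, *«(R(u)U′)(x, x′) = R(u(x))U′(x, x′)»*).  No lattice geometry, no group structure and no analytic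
content is modelled: every lemma is the algebra of the shapes.  DIVERGENCE D-b13.27 (schematic typing).

WHAT THIS FILE CERTIFIES ([folklore] throughout; each § names the device of the companion census it types).
§A SHAPES AND THEIR ALGEBRA (devices D2 scalar weights / D6 algebraic combinations): `Cov` is closed under
  composition, configuration-independent scalar weights, sums, finite sums and list products (`Cov.comp`, `Cov.smul`,
  `Cov.add`, `Cov.sum`, `Cov.listProd`) — so an `s`-weighted generalized-random-walk sum `Σ_ω s^{m(ω)} R₀R_{α₁}⋯R_{αₙ}`
  of covariant factors is covariant (`Cov.walkSum`, the shape of (1.6)/(1.8) p. 3 and (2.8) p. 14); `Inv` is closed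
  under outer maps and pairs (`Inv.map`, `Inv.map₂`), and a `ρ`-invariant pairing of a covariant operator is an
  invariant function (`Inv.pairing`, the shape of (3.30)–(3.31) [13]).
§B LATTICE DEVICES (D1 position scalars and domain restrictions, D4 field cut-offs): the fibrewise action commutes with
  position-dependent scalar multipliers `ζ_□`, `h` (`fibrewise_smul_position`, (1.1) p. 2) and with restriction to a
  domain (`fibrewise_indicator`; hence compressions `Ω₀TΩ₀` of covariant `T` are covariant, `Cov.compress`, (3.27)
  [13]); a product of cut-off functions of fibre norms `Π_b χ_b(|B(b)|)` is invariant when every `R(u(b))` preserves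
  the fibre norm (`inv_cutoff_prod`, (2.3) p. 12 — the hypothesis holds for `G`-valued `u` (orthogonal adjoint
  action), which is all p. 21 uses; it fails for `Gᶜ`-valued `u`, and the file says nothing there).
§C PARAMETER DEVICES (D3: `∂/∂t`, `∫₀¹ dt_□`, contour integrals in `s(Δ)`, evaluation at `s = 0`, (1.9)–(1.10) p. 4,
  (1.23) p. 7, (2.1) p. 12, (2.9) p. 14): a parameter-wise invariant family stays invariant under ANY operation acting
  on the parameter alone (`Inv.paramOp`).
§D FIXED-POINT DEVICE (D8: the solutions `D(H(s), ·)`, `A₀(H(s), G̃(s), ·)` of (1.3)–(1.5), (1.12)–(1.16) pp. 2–3, 5–6):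
  the unique fixed point, inside a `ρ`-stable set, of a covariant family of maps is covariant (`fixedPoint_cov`) —
  uniqueness in the ball is [II] p. 5 / `B13Contraction113`, entering here as the hypothesis `huniq`.
§E TAYLOR DEVICES (D10 = the move of [13] p. 395 quoted above; (1.38)–(1.42) pp. 10–11): for a ℂ-homogeneous `L`
  (`L (t • w) = t • L w`), `slice (f ∘ L) w = slice f (L w)`, hence `homPart (f ∘ L) n w = homPart f n (L w)`,
  `rem (f ∘ L) n w = rem f n (L w)`, `BeginsAt f n → BeginsAt (f ∘ L) n` (`slice_comp`, `homPart_comp`, `rem_comp`,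
  `beginsAt_comp`); so a JOINTLY invariant family `F (g a) (L w) = F a w` has jointly invariant homogeneous parts and
  remainders of every order (`homPart_inv`, `rem_inv`: *«both terms in (1.42)»* in the `homPart 2 / rem 2` reading of
  `B13ExpansionOrder`), and — for a continuous linear automorphism `iso` — the printed second-derivative coefficients
  (1.40) transform by conjugation: `d2 (f ∘ iso) p u v = d2 f (iso p) (iso u) (iso v)`, `coeff140 (f ∘ iso) B u v =
  coeff140 f (iso B) (iso u) (iso v)` (hypothesis-free, `d2_comp_equiv`, `coeff140_comp_equiv`), whence
  `coeff140 (F (g a)) (iso B) (iso u) (iso v) = coeff140 (F a) B u v` (`coeff140_inv`: the operator `Q(Y, B)` of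
  (1.42) is covariant and its quadratic form invariant, in the `coeff140` reading of `B13Ineq140` / `B13PkScaling`).
§F (v1.1, APPEND-ONLY) INVERSE DEVICE (D6′: the Green's functions `G(U) = (Δ_a↾Ω₀)⁻¹` of (3.27) [13], the propagators
  `G̃_k(Ω)`, `C^{(j)}` of p. 3, the resolvents `(xI + C*Δ_kC)⁻¹` of (2.7) p. 13 and hence, with §C, the square root
  `(C^{(k)})^{1/2} = (1/π)∫₀^∞ dx x^{-1/2}(xI + C*Δ_kC)⁻¹`): a two-sided inverse of a covariant family is covariant
  (`Cov.inverse`), a scalar shift `xI + T(U)` of a covariant family is covariant (`Cov.shift`), so resolvents are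
  (`Cov.resolvent`), for ANY `ρ` resp. linear `ρ` — no invertibility of `ρ` is used.  `Cov.inverse` wants the
  two-sided inverse ON THE CARRIER `Φ`: for `G(U) = (Δ_a↾Ω₀)⁻¹` read `Φ :=` the fields on `Ω₀` (`ρ`-stable by
  `fibrewise_indicator`), where `Δ_a↾Ω₀` is invertible — not the ambient space, where `Ω₀Δ_aΩ₀` is not (C-adv2-71 R2).
§G (v1.2, APPEND-ONLY) NEIGHBOURHOOD / DOMAIN CLAUSE (device D11, *«belong to proper spaces also»*, *«almost the same
  bounds as J, B»* [I] p. 276; the `Gᶜ`-side of D8): two-space covariance `CovWith` (operators between different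
  carriers: `H(s(Y₀))`, `C` of (1.13)); the fixed-point device with the EXACT domain hypothesis — only the image `R(u)X`
  of the solution must lie in the uniqueness domain (`fixedPoint_cov_of_image`, `fixedPoint_cov₂_on`); near-isometries
  `‖R(u)X‖ ≤ M‖X‖` and nested balls (`mapsTo_ball_div_of_norm_le`, `norm_fibrewise_le`; the dictionary `norm_conj_le`:
  `M = ‖u‖‖u⁻¹‖ ≥ 1` for the adjoint-type action of a `Gᶜ`-valued `u`, `= 1` for a unitary one, `norm_conj_unitary`);
  and device D8 DISCHARGED over the kernel fixed point of `B13Contraction113`: the solution map `solD` of (1.13)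
  satisfies `D(H(Uᵘ), R(u)A′) = R(u)D(H(U), A′)` for `|A′| < ε₂/M` (`solD_cov`: by (1.14), `|R(u)D(H(U), A′)| ≤
  M·4C₂|A′|² ≤ 4C₂ε₂²` puts the image in the uniqueness ball at the transformed datum, of norm `< ε₂`), i.e. on the
  full printed domain `|A′| < ε₂` when `M = 1` (`solD_cov_of_norm_le_one`) — the typed content, for this device, of
  *«sufficiently small neighborhood of G-valued transformations»*: the price of `Gᶜ` is the factor `M` in the radius
  (C-adv2-71 R3: in v1/v1.1 that proviso was the bare hypothesis `MapsTo ρ K K` of `fixedPoint_cov`).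
§H (v1.3, APPEND-ONLY) GAUSSIAN CONDITIONING DEVICE (D5: (2.5)–(2.6) pp. 12–13, *«in a similar way to (2.28) [6], namely
  as conditioning on Z₀ᶜ»*), over a finite-dimensional model (`x : Λ → ℝ` = `Z₀B`, `y : C → ℝ` = `Z₀ᶜB′`, Lebesgue `dB`,
  `C*Δ_kC` a real block matrix `(A, B; Bᵀ, D)`, `C^{(k)}(Z₀) = A⁻¹`; DIVERGENCE D-b13.29): the completed square of (2.5) is
  `B2.completeSquare228` at source `0` with the remainder identified as the Schur form and the energy of the
  conditional mean `μ(y) = −A⁻¹By` as the printed sandwich (`condExponent_eq`, `condMean_energy`, `sandwich_eq`); the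
  linear shift `∫dx e^{−⟨j,x⟩−½⟨x,Ax⟩}Ψ(x) = e^{½⟨j,A⁻¹j⟩}∫dx e^{−½⟨x,Ax⟩}Ψ(x − A⁻¹j)` for EVERY `Ψ`
  (`integral_linear_shift`); the SECOND equality of (2.5) at fixed `Z₀ᶜB′`, hypothesis-free (`ratio_25`); the FIRST
  equality (conditioning = iterated integration with the conditional density written as the printed ratio) under
  integrability and non-vanishing denominators (`totalExpectation_25`; both: `display_25`); the change of variables
  `∫dx Ψ(Tx) = |det T|⁻¹∫dx Ψ(x)` (`integral_comp_mulVec`) and the whitening (2.6) `∫dμ₀(X)Φ(TX) = ∫dμ_{A⁻¹}(B′)Φ(B′)`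
  for any `T` with `TᵀAT = 1` (`gaussMean_whiten`); and the GAUGE TRANSPORT of every object of (2.5)–(2.6) under a
  block-orthogonal `R(u) = (R₁, R₂)` with the blockwise covariance `A ↦ R₁AR₁ᵀ, B ↦ R₁BR₂ᵀ, D ↦ R₂DR₂ᵀ` as HYPOTHESIS:
  `C^{(k)}(Z₀) ↦ R₁C^{(k)}(Z₀)R₁ᵀ` (`inv_conj`), `μ(R₂y) = R₁μ(y)` (`condMean_conj`), Schur / sandwich operators
  conjugate (`schur_conj`, `sandwich_conj`), all exponents invariant (`quadForm_conj`, `crossForm_conj`,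
  `dotProduct_conj`, `sandwich_inv`), `dB` invariant (`integral_comp_mulVec_of_transpose_mul_self`), hence the
  normalised Gaussian means covariant — `∫dμ_{(RARᵀ)⁻¹}Ψ = ∫dμ_{A⁻¹}(Ψ ∘ R)` (`gaussMean_conj`), in §A's vocabulary
  `Inv g R Ψ → ∫dμ_{C(gU)}Ψ(gU) = ∫dμ_{C(U)}Ψ(U)` (`gaussMean_inv`) — and `dμ₀` rotation invariant (`gaussMean_one_conj`).

NOT CERTIFIED HERE: the covariance of any specific operator of [I], [13], [15] (hypotheses `Cov …`; in §H the
blockwise covariance of `C*Δ_kC(U)` and the covariance of `(C^{(k)})^{1/2}(U)`, the latter being §F + §C applied to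
(2.7)); the positivity of `C*Δ_kC` and the convergence of the Gaussian integrals (in §H only `A.IsSymm`, `IsUnit A.det`,
integrability / non-vanishing enter, where stated); the expansions (2.7)–(2.9) and the functional calculus of
`C^{(k)}(U)`; anything about `Gᶜ`-valued `u` beyond linearity and the near-isometry / shrunken-domain bookkeeping of §G (the
analytic-continuation step of p. 21 is GAPS G-B13-06a / C-B13 records, `B12Inv329.orbitExtension_iff`; the covariance
`CovWith` of [15]'s `C`, `H(s(Y₀))` and the `u`-uniformity of their constants `C₂, R, B₀e^{16κ₁}` stay hypotheses); the [I]-side statement *«(3.25), (3.26) are gauge invariant»* (GAPS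
G-adv7-7).  Units `b2b-balaban-b13-g17` (v1, v1.1), `b2b-balaban-b13-g18` (v1.2), `b2b-balaban-b13-g19` (v1.3); cell
records GAPS C-B13-36, C-B13-39, C-B13-42, DIVERGENCE D-b13.27, D-b13.28, D-b13.29.  VERSIONS: v1 = p185800 (commit 83710beaf159); v1.1 = p185834 (5e70e4115697)
= v1 with §F appended; v1.2 = v1.1 with §G appended, ONE import added (`B13Contraction113`, used in §G.3 only) and the
header DOCFIX C-adv2-71 (M1: the (3.30) transcript now reads «Jᵘ» as printed, twice; R2, R3: the sentences so marked)
— this header's §-list, model paragraph and version line extended; no v1 / v1.1 declaration, statement, proof or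
docstring modified; v1.2 = p186778 (f6f69818469b).  v1.3 = v1.2 with §H appended, ONE import added (`B2`, used in §H.1
only: `B2.completeSquare228`) and the §G section-docstring DOCFIX C-pv08g4-5 (DOCFIX-1: the dangling name
`solD_cov_of_norm_eq` → the declared `solD_cov_of_norm_le_one`; DOCFIX-2: *«almost the same bounds as J, B»* attributed
to the paragraph of [I] p. 276 PRECEDING (3.29), as printed) — this header's citation list, §-list, NOT-CERTIFIED
paragraph and version line extended; no v1 / v1.1 / v1.2 declaration, statement or proof modified.  v1.4 (cell
`lit-balaban`, seat r10 gen 20, 2026-08-22; DOCSTRING-ONLY citeloc fix, Lean code byte-identical to v1.3): [II] display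
locators corrected against the renders `…-p002-x2.png`, `…-p007-x2.png`, `…-p012-x2.png` and the text layer (`p0005.txt`,
`p0006.txt`): (2.3) «p. 13» → p. 12 (header §B, `inv_cutoff_prod` docstring + citation tag); (1.23) «p. 6» → p. 7 (header §C,
`Inv.paramOp` docstring); (1.3)–(1.5) «p. 3» → pp. 2–3 and (1.12)–(1.16) «pp. 4–5» → pp. 5–6 (header §D, `fixedPoint_cov` and
`CovWith` docstrings; (1.3), (1.4) are printed on p. 2, (1.5) on p. 3, (1.12)–(1.14) on p. 5, (1.15)–(1.16) on p. 6); the (2.3)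
item was flagged by the cell՚s CITELOC sweep (`lit-balaban-r12/CITELOC-SWEEP-g14.md` §11), the others found at this touch; the
cell՚s verbatim framing sentence added on page 1; no declaration, statement or proof modified.
-/

namespace Literature.MathematicalPhysics.QuantumFieldTheory.Balaban1983to89.B13GaugeDevices

open Set MeasureTheory
open scoped BigOperators

/-! ## §A. The two printed shapes and their algebra -/

section Shapes

variable {𝔘 Φ X Y Z : Type*}

/-- *«gauge invariant with respect to the simultaneous gauge transformations U → Uᵘ, J → R(u)J, B → R(u)B»* ([I] (3.29)
p. 276; [II] Lemma 2 p. 11), for ONE fixed `u`: `g` = its action on the external configurations, `ρ` = `R(u)` on the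
linearly-acting variable. [cite: Balaban1988RG2Cluster, Lemma 2 p.11] -/
def Inv (g : 𝔘 → 𝔘) (ρ : Φ → Φ) (f : 𝔘 → Φ → X) : Prop :=
  ∀ U φ, f (g U) (ρ φ) = f U φ

/-- *«T(Uᵘ) = R(u)T(U)R(u⁻¹)»* — the transformation law (3.30), (3.31), (3.33), (3.34) of [13] for a
configuration-dependent operator, written `T(Uᵘ)R(u) = R(u)T(U)`. [cite: Balaban1985BackgroundPropagators, (3.28)–(3.34) p.395–396] -/
def Cov (g : 𝔘 → 𝔘) (ρ : Φ → Φ) (T : 𝔘 → Φ → Φ) : Prop :=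
  ∀ U φ, T (g U) (ρ φ) = ρ (T U φ)

variable {g : 𝔘 → 𝔘} {ρ : Φ → Φ}

/-- Device D6 (outer functions: `exp`, `log`, products, Mayer / polymer combinations (2.1), (2.11)–(2.13)): an outer
map of an invariant function is invariant. [folklore] -/
theorem Inv.map {f : 𝔘 → Φ → X} (hf : Inv g ρ f) (φ' : X → Y) : Inv g ρ (fun U φ => φ' (f U φ)) := by
  intro U φ
  simp only [hf U φ]

/-- Device D6, binary form (sums, products, pairings of two invariant functions). [folklore] -/
theorem Inv.map₂ {f₁ : 𝔘 → Φ → X} {f₂ : 𝔘 → Φ → Y} (h₁ : Inv g ρ f₁) (h₂ : Inv g ρ f₂) (β : X → Y → Z) :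
    Inv g ρ (fun U φ => β (f₁ U φ) (f₂ U φ)) := by
  intro U φ
  simp only [h₁ U φ, h₂ U φ]

/-- Device D6, finitary form: a finite sum of invariant functions is invariant. [folklore] -/
theorem Inv.sum [AddCommMonoid X] {Ω : Type*} (W : Finset Ω) {f : Ω → 𝔘 → Φ → X}
    (hf : ∀ ω ∈ W, Inv g ρ (f ω)) : Inv g ρ (fun U φ => ∑ ω ∈ W, f ω U φ) := by
  intro U φ
  exact Finset.sum_congr rfl fun ω hω => hf ω hω U φ

/-- Device D6, finitary form: a finite product of invariant functions is invariant. [folklore] -/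
theorem Inv.prod [CommMonoid X] {Ω : Type*} (W : Finset Ω) {f : Ω → 𝔘 → Φ → X}
    (hf : ∀ ω ∈ W, Inv g ρ (f ω)) : Inv g ρ (fun U φ => ∏ ω ∈ W, f ω U φ) := by
  intro U φ
  exact Finset.prod_congr rfl fun ω hω => hf ω hω U φ

/-- The shape of (3.30)–(3.31) [13]: a pairing preserved by `R(u)` (*«⟨R(u)λ, Δ(Uᵘ)R(u)λ⟩ = ⟨λ, Δ(U)λ⟩»*) of the
variable with a covariant operator applied to it is an invariant function — the quadratic forms `⟨B, Δ^{(k)}(U)B⟩`,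
`⟨B′, Q(Y, U, J, B)B′⟩`. [cite: Balaban1985BackgroundPropagators, (3.30)–(3.31) p.395] -/
theorem Inv.pairing {T : 𝔘 → Φ → Φ} (β : Φ → Φ → X) (hβ : ∀ x y, β (ρ x) (ρ y) = β x y) (hT : Cov g ρ T) :
    Inv g ρ (fun U φ => β φ (T U φ)) := by
  intro U φ
  simp only [hT U φ, hβ]

/-- Device D2/D6: covariant operators compose (the walk terms `R₀(X₀)R_{α₁}(X₁)⋯R_{αₙ}(Xₙ)` of (1.6)). [folklore] -/
theorem Cov.comp {T₁ T₂ : 𝔘 → Φ → Φ} (h₁ : Cov g ρ T₁) (h₂ : Cov g ρ T₂) :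
    Cov g ρ (fun U => T₁ U ∘ T₂ U) := by
  intro U φ
  simp only [Function.comp_apply, h₂ U φ, h₁ U (T₂ U φ)]

/-- The identity operator is covariant. [folklore] -/
theorem cov_identity : Cov g ρ (fun _ => (id : Φ → Φ)) := fun _ _ => rfl

/-- Device D2/D6: a list product (iterated composition) of covariant factors is covariant. [folklore] -/
theorem Cov.listProd (l : List (𝔘 → Φ → Φ)) (hl : ∀ T ∈ l, Cov g ρ T) :
    Cov g ρ (fun U => (l.map fun T => T U).foldr (· ∘ ·) id) := by
  induction l with
  | nil => exact cov_identity
  | cons T l ih =>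
      have hT : Cov g ρ T := hl T (by simp)
      have hl' : Cov g ρ (fun U => (l.map fun T => T U).foldr (· ∘ ·) id) :=
        ih fun T' hT' => hl T' (by simp [hT'])
      intro U φ
      have e := hl' U φ
      dsimp only at e
      simp only [List.map_cons, List.foldr_cons, Function.comp_apply]
      rw [e, hT U]

variable {𝕜 : Type*} [Semiring 𝕜] [AddCommMonoid Φ] [Module 𝕜 Φ]

/-- Device D2 (the decoupling weights `s(Δ₁)·…·s(Δ_m)` of p. 3 and (2.8) p. 14 are configuration-independent
scalars): a scalar multiple of a covariant operator is covariant, `R(u)` being linear. [folklore] -/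
theorem Cov.smul (ρ : Φ →ₗ[𝕜] Φ) {T : 𝔘 → Φ → Φ} (hT : Cov g ρ T) (c : 𝕜) :
    Cov g ρ (fun U φ => c • T U φ) := by
  intro U φ
  simp only [hT U φ, map_smul]

/-- Device D6: a sum of covariant operators is covariant, `R(u)` being additive. [folklore] -/
theorem Cov.add (ρ : Φ →ₗ[𝕜] Φ) {T₁ T₂ : 𝔘 → Φ → Φ} (h₁ : Cov g ρ T₁) (h₂ : Cov g ρ T₂) :
    Cov g ρ (fun U φ => T₁ U φ + T₂ U φ) := by
  intro U φ
  simp only [h₁ U φ, h₂ U φ, map_add]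

/-- Device D6: a finite sum of covariant operators is covariant. [folklore] -/
theorem Cov.sum (ρ : Φ →ₗ[𝕜] Φ) {Ω : Type*} (W : Finset Ω) {T : Ω → 𝔘 → Φ → Φ}
    (hT : ∀ ω ∈ W, Cov g ρ (T ω)) : Cov g ρ (fun U φ => ∑ ω ∈ W, T ω U φ) := by
  intro U φ
  rw [map_sum]
  exact Finset.sum_congr rfl fun ω hω => hT ω hω U φ

/-- **The generalized-random-walk shape (1.6)/(1.8) p. 3, (2.8) p. 14.**  *«we take the expansion (1.6) and we
multiply each term by the product s(Δ₁)·…·s(Δ_m)»*: if every factor `R_α(X)` of every walk `ω` is covariant, the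
`s`-weighted sum `H(s) = Σ_ω c(ω)·R_{ω,1}∘⋯∘R_{ω,n(ω)}` is covariant — for every value of the parameters. [cite: Balaban1988RG2Cluster, (1.6)–(1.8) p.3] -/
theorem Cov.walkSum (ρ : Φ →ₗ[𝕜] Φ) {Ω : Type*} (W : Finset Ω) (c : Ω → 𝕜)
    (factors : Ω → List (𝔘 → Φ → Φ)) (hcov : ∀ ω ∈ W, ∀ T ∈ factors ω, Cov g ρ T) :
    Cov g ρ (fun U φ => ∑ ω ∈ W, c ω • ((factors ω).map fun T => T U).foldr (· ∘ ·) id φ) :=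
  Cov.sum ρ W fun ω hω => Cov.smul ρ (Cov.listProd (factors ω) (hcov ω hω)) (c ω)

end Shapes

/-! ## §B. Lattice devices: position scalars, domain restrictions, cut-offs -/

section Lattice

variable {𝕜 : Type*} [Semiring 𝕜] {ι V : Type*} [AddCommMonoid V] [Module 𝕜 V]

/-- The fibrewise action of a field of linear maps on lattice functions: `(R(u)U′)(x, x′) = R(u(x))U′(x, x′)`
([13] (3.28) p. 395), `(R(u)B)(b) = R(u(b₋))B(b)`. [cite: Balaban1985BackgroundPropagators, (3.28) p.395] -/
def fibrewise (r : ι → V →ₗ[𝕜] V) (φ : ι → V) : ι → V := fun i => r i (φ i)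

/-- `(R(u)φ)(i) = R(u(i))φ(i)`. [folklore] -/
@[simp] theorem fibrewise_apply (r : ι → V →ₗ[𝕜] V) (φ : ι → V) (i : ι) :
    fibrewise r φ i = r i (φ i) := rfl

/-- Device D1 (the position scalars `ζ_□`, `ζ̃_□` of (1.1) p. 2, the cut-off function `h`, characteristic functions
of domains): multiplication by a position-dependent scalar commutes with the fibrewise action. [folklore] -/
theorem fibrewise_smul_position (r : ι → V →ₗ[𝕜] V) (ζ : ι → 𝕜) (φ : ι → V) :
    fibrewise r (fun i => ζ i • φ i) = fun i => ζ i • fibrewise r φ i := by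
  funext i
  simp only [fibrewise_apply, map_smul]

/-- Device D1 (restriction to a localization domain, *«Δ_a↾Ω₀ = Ω₀Δ_aΩ₀»* (3.27) [13]; the domains `X_i` of the walk
factors `R_{α_i}(X_i)`): restriction to a set of sites commutes with the fibrewise action. [folklore] -/
theorem fibrewise_indicator (r : ι → V →ₗ[𝕜] V) (S : Set ι) (φ : ι → V) :
    fibrewise r (S.indicator φ) = S.indicator (fibrewise r φ) := by
  classical
  funext i
  simp only [fibrewise_apply, Set.indicator_apply]
  split_ifs <;> simp

/-- The fibrewise action is additive. [folklore] -/
theorem fibrewise_add (r : ι → V →ₗ[𝕜] V) (φ ψ : ι → V) :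
    fibrewise r (φ + ψ) = fibrewise r φ + fibrewise r ψ := by
  funext i
  simp only [fibrewise_apply, Pi.add_apply, map_add]

/-- The fibrewise action as a linear map of lattice functions. [folklore] -/
def fibrewiseₗ (r : ι → V →ₗ[𝕜] V) : (ι → V) →ₗ[𝕜] (ι → V) where
  toFun := fibrewise r
  map_add' := fibrewise_add r
  map_smul' c φ := by
    funext i
    simp only [fibrewise_apply, Pi.smul_apply, map_smul, RingHom.id_apply]

/-- `fibrewiseₗ r` is `fibrewise r`. [folklore] -/
@[simp] theorem fibrewiseₗ_apply (r : ι → V →ₗ[𝕜] V) (φ : ι → V) : fibrewiseₗ r φ = fibrewise r φ := rfl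

/-- Device D1 for operators: the compression `Ω₀TΩ₀` (restriction with Dirichlet conditions, (3.27) [13]; the
localized operators `R_α(X)`, `H(□)`, `C^{(k)}(Z₀)`) of a covariant operator is covariant. [folklore] -/
theorem Cov.compress {𝔘 : Type*} {g : 𝔘 → 𝔘} (r : ι → V →ₗ[𝕜] V) (S : Set ι) {T : 𝔘 → (ι → V) → (ι → V)}
    (hT : Cov g (fibrewise r) T) :
    Cov g (fibrewise r) (fun U φ => S.indicator (T U (S.indicator φ))) := by
  intro U φ
  simp only [← fibrewise_indicator, hT U]

/-- Device D1 for operators: multiplication by a position scalar composed with a covariant operator is covariant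
(the operators `ζ_□H_k(□)`, `h·D̃`, …). [folklore] -/
theorem Cov.smul_position {𝔘 : Type*} {g : 𝔘 → 𝔘} (r : ι → V →ₗ[𝕜] V) (ζ : ι → 𝕜)
    {T : 𝔘 → (ι → V) → (ι → V)} (hT : Cov g (fibrewise r) T) :
    Cov g (fibrewise r) (fun U φ i => ζ i • T U φ i) := by
  intro U φ
  show (fun i => ζ i • T (g U) (fibrewise r φ) i) = fibrewise r (fun i => ζ i • T U φ i)
  rw [hT U φ]
  exact (fibrewise_smul_position r ζ (T U φ)).symm

/-- Device D4 (the field cut-offs `χ({|B(b)| ≥ ε₁/g_k})`, `χ_k(Z)` of (2.3) p. 12): a product over bonds of functions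
of the fibre norms is invariant as soon as every `R(u(b))` preserves the fibre norm — true for `G`-valued `u` acting by
the (orthogonal) adjoint representation, which is all that p. 21 uses (*«gauge invariant with respect to all G-valued
transformations»*); nothing is claimed for `Gᶜ`-valued `u`. [cite: Balaban1988RG2Cluster, (2.3) p.12] -/
theorem inv_cutoff_prod {𝔘 W X : Type*} [SeminormedAddCommGroup W] [CommMonoid X] {g : 𝔘 → 𝔘}
    (r : ι → W → W) (hr : ∀ b w, ‖r b w‖ = ‖w‖) (P : Finset ι) (χ : ι → ℝ → X) :
    Inv g (fun (φ : ι → W) b => r b (φ b)) (fun _ φ => ∏ b ∈ P, χ b ‖φ b‖) := by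
  intro U φ
  simp only [hr]

end Lattice

/-! ## §C. Parameter devices -/

section Parameter

variable {𝔘 Φ P X Y : Type*} {g : 𝔘 → 𝔘} {ρ : Φ → Φ}

/-- Device D3 (differentiation `∂/∂t`, `∂/∂t_□` and integration `∫₀¹` in (1.9)–(1.10) p. 4, the Cauchy contour
integrals in `s(Δ)` behind (1.23) p. 7 and (2.9) p. 14, evaluation at `s = 0` off `σ`, the `∂^σ/∂s^σ` of the Mayer
expansion (2.1) p. 12): if a family is invariant for EVERY value of the parameter, then any operation `Λ` acting on the
parameter dependence alone yields an invariant function. [cite: Balaban1988RG2Cluster, (1.9)–(1.10) p.4] -/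
theorem Inv.paramOp {F : P → 𝔘 → Φ → X} (hF : ∀ p, Inv g ρ (F p)) (Λ : (P → X) → Y) :
    Inv g ρ (fun U φ => Λ (fun p => F p U φ)) := by
  intro U φ
  have h : (fun p => F p (g U) (ρ φ)) = fun p => F p U φ := funext fun p => hF p U φ
  simp only [h]

/-- Device D3 for operators: a parameter operation which commutes with `R(u)` (e.g. `Λ` linear and `R(u)` linear and
continuous: `∂/∂t`, `∫ dt`, contour integrals) applied to a parameter-wise covariant family gives a covariant
operator — stated with the commutation as the hypothesis `hΛ`. [folklore] -/
theorem Cov.paramOp {T : P → 𝔘 → Φ → Φ} (hT : ∀ p, Cov g ρ (T p)) (Λ : (P → Φ) → Φ)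
    (hΛ : ∀ G : P → Φ, Λ (fun p => ρ (G p)) = ρ (Λ G)) :
    Cov g ρ (fun U φ => Λ (fun p => T p U φ)) := by
  intro U φ
  have h : (fun p => T p (g U) (ρ φ)) = fun p => ρ (T p U φ) := funext fun p => hT p U φ
  simp only [h, hΛ]

end Parameter

/-! ## §D. The fixed-point device -/

section FixedPoint

variable {𝔘 Φ : Type*} {g : 𝔘 → 𝔘} {ρ : Φ → Φ}

/-- Device D8 (the solutions `D(H, A′)`, `A₀(H, G̃, H₀B′)` of (1.3)–(1.5) pp. 2–3 and of the `s`-dependent equations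
(1.12)–(1.16) pp. 5–6, *«the fixed point is an analytic function of A′, s(Y₀), bounded by 4C₂ε₂²»*): if the defining
maps are covariant, `R(u)` maps the uniqueness domain `K` into itself, and the solution is THE unique fixed point in
`K`, then the solution map is covariant.  Uniqueness is the hypothesis `huniq` ([II] p. 5; `B13Contraction113`). [cite: Balaban1988RG2Cluster, (1.12)–(1.14) p.4–5] -/
theorem fixedPoint_cov {T : 𝔘 → Φ → Φ} (hT : Cov g ρ T) {K : Set Φ} (hρ : MapsTo ρ K K) {S : 𝔘 → Φ}
    (hSK : ∀ U, S U ∈ K) (hfix : ∀ U, T U (S U) = S U) (huniq : ∀ U x, x ∈ K → T U x = x → x = S U)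
    (U : 𝔘) : S (g U) = ρ (S U) := by
  symm
  apply huniq (g U) (ρ (S U)) (hρ (hSK U))
  rw [hT U (S U), hfix U]

/-- Device D8 with a configuration-dependent datum transforming under `ρ'` (the variable `A′ ↦ R(u)A′` of `D(H, A′)`):
the same statement for maps `T U a` and solutions `S U a` indexed by `a`, with `T (g U) (ρ' a) (ρ x) = ρ (T U a x)`. [folklore] -/
theorem fixedPoint_cov₂ {A : Type*} {ρ' : A → A} {T : 𝔘 → A → Φ → Φ}
    (hT : ∀ U a x, T (g U) (ρ' a) (ρ x) = ρ (T U a x)) {K : Set Φ} (hρ : MapsTo ρ K K) {S : 𝔘 → A → Φ}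
    (hSK : ∀ U a, S U a ∈ K) (hfix : ∀ U a, T U a (S U a) = S U a)
    (huniq : ∀ U a x, x ∈ K → T U a x = x → x = S U a) (U : 𝔘) (a : A) :
    S (g U) (ρ' a) = ρ (S U a) := by
  symm
  apply huniq (g U) (ρ' a) (ρ (S U a)) (hρ (hSK U a))
  rw [hT U a (S U a), hfix U a]

end FixedPoint

/-! ## §E. Taylor devices: homogeneous parts, remainders, and the coefficients (1.40) -/

section Taylor

open B13ExpansionOrder (slice homPart rem BeginsAt)
open B13Ineq140 (d2 coeff140)

variable {E E' F : Type*} [NormedAddCommGroup E] [NormedSpace ℂ E] [NormedAddCommGroup E'] [NormedSpace ℂ E']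
  [NormedAddCommGroup F] [NormedSpace ℂ F]

omit [NormedAddCommGroup F] [NormedSpace ℂ F] in
/-- *«R(u)A is linear in A»* ⟹ the complex slices through `0` of `f ∘ L` are slices of `f`:
`t ↦ f(L(t•w)) = f(t•Lw)`.  Only ℂ-homogeneity of `L` is used. [cite: Balaban1985BackgroundPropagators, (3.29)–(3.30) p.395] -/
theorem slice_comp {f : E' → F} {L : E → E'} (hL : ∀ (t : ℂ) (w : E), L (t • w) = t • L w) (w : E) :
    slice (f ∘ L) w = slice f (L w) := by
  funext t
  simp only [B13ExpansionOrder.slice_apply, Function.comp_apply, hL]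

/-- *«expanding both sides of the above equality in A we get a sequence of equalities between homogeneous polynomials
of the same order»* ([13] p. 395): the order-`n` homogeneous part of `f ∘ L` at `w` is that of `f` at `L w`. [cite: Balaban1985BackgroundPropagators, (3.29)–(3.30) p.395] -/
theorem homPart_comp {f : E' → F} {L : E → E'} (hL : ∀ (t : ℂ) (w : E), L (t • w) = t • L w) (n : ℕ) (w : E) :
    homPart (f ∘ L) n w = homPart f n (L w) := by
  simp only [B13ExpansionOrder.homPart, slice_comp hL]

/-- The same for the remainder after the order-`n` part (`D̃₃`, `V″_k` readings). [folklore] -/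
theorem rem_comp {f : E' → F} {L : E → E'} (hL : ∀ (t : ℂ) (w : E), L (t • w) = t • L w) (n : ℕ) (w : E) :
    rem (f ∘ L) n w = rem f n (L w) := by
  simp only [B13ExpansionOrder.rem, homPart_comp hL, Function.comp_apply]

omit [NormedSpace ℂ F] in
/-- The onset order is preserved: *«an expansion beginning with n-th order terms»* for `f` gives the same for `f ∘ L`. [folklore] -/
theorem beginsAt_comp {f : E' → F} {L : E → E'} (hL : ∀ (t : ℂ) (w : E), L (t • w) = t • L w) {n : ℕ}
    (h : BeginsAt f n) : BeginsAt (f ∘ L) n := by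
  intro w
  rw [slice_comp hL]
  exact h (L w)

variable {𝔘 : Type*} {g : 𝔘 → 𝔘}

/-- **Device D10, *«both terms in (1.42) are gauge invariant»* (Lemma 2 p. 11), homogeneous-part reading.**  If the
family `F` is jointly invariant, `F (g a) (L w) = F a w` with `L = R(u)` ℂ-homogeneous, then so is the family of its
order-`n` homogeneous parts — [13] p. 395's *«equalities between homogeneous polynomials of the same order»*. [cite: Balaban1988RG2Cluster, Lemma 2 (1.42) p.11] -/
theorem homPart_inv {F' : 𝔘 → E → F} {L : E → E} (hL : ∀ (t : ℂ) (w : E), L (t • w) = t • L w)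
    (hF : Inv g L F') (n : ℕ) : Inv g L (fun a w => homPart (F' a) n w) := by
  intro a w
  show homPart (F' (g a)) n (L w) = homPart (F' a) n w
  have h : F' (g a) ∘ L = F' a := funext fun w => hF a w
  rw [← homPart_comp hL, h]

/-- **Device D10, remainder reading**: the remainders `rem (F a) n` of a jointly invariant family are jointly invariant
(the term `V″_k(Y, B)` of (1.42) as `V_k −` its quadratic part; `D̃₃`, `G₃`, `V` of (I.2.12)). [cite: Balaban1988RG2Cluster, Lemma 2 (1.42) p.11] -/
theorem rem_inv {F' : 𝔘 → E → F} {L : E → E} (hL : ∀ (t : ℂ) (w : E), L (t • w) = t • L w)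
    (hF : Inv g L F') (n : ℕ) : Inv g L (fun a w => rem (F' a) n w) := by
  intro a w
  show rem (F' (g a)) n (L w) = rem (F' a) n w
  have h : F' (g a) ∘ L = F' a := funext fun w => hF a w
  rw [← rem_comp hL, h]

/-- The chain rule through a continuous linear equivalence, applied form (hypothesis-free: Mathlib's
`ContinuousLinearEquiv.comp_right_fderiv`). [folklore] -/
theorem fderiv_comp_equiv_apply (f : E' → F) (iso : E ≃L[ℂ] E') (x v : E) :
    fderiv ℂ (f ∘ iso) x v = fderiv ℂ f (iso x) (iso v) := by
  rw [iso.comp_right_fderiv]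
  rfl

/-- **The printed second derivatives (1.40) transform by conjugation**: `∂²(f ∘ R)(p)[u, v] = ∂²f(Rp)[Ru, Rv]` for a
continuous linear automorphism `R` — with NO differentiability hypothesis (both sides take the same junk values). [cite: Balaban1988RG2Cluster, (1.40) p.10] -/
theorem d2_comp_equiv (f : E' → F) (iso : E ≃L[ℂ] E') (p u v : E) :
    d2 (f ∘ iso) p u v = d2 f (iso p) (iso u) (iso v) := by
  unfold B13Ineq140.d2
  have h : (fun z => fderiv ℂ (f ∘ ⇑iso) z v) = (fun y => fderiv ℂ f y (iso v)) ∘ ⇑iso := by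
    funext z
    exact fderiv_comp_equiv_apply f iso z v
  rw [h]
  exact fderiv_comp_equiv_apply _ iso p u

/-- **The coefficients (1.40) `∫₀¹(1 − t) ∂²f(tB′)[u, v] dt` transform by conjugation** (hypothesis-free). [cite: Balaban1988RG2Cluster, (1.40) p.10] -/
theorem coeff140_comp_equiv (f : E' → F) (iso : E ≃L[ℂ] E') (B u v : E) :
    coeff140 (f ∘ iso) B u v = coeff140 f (iso B) (iso u) (iso v) := by
  unfold B13Ineq140.coeff140
  congr 1
  funext t
  rw [d2_comp_equiv, map_smul]

/-- **Device D10, (1.40)/(1.42) reading: the operator `Q(Y, B)` of the quadratic form is covariant**, i.e. its matrix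
elements at the transformed configuration and transformed directions equal the original ones, whenever the generating
family (1.38) is jointly invariant under `(U, J) ↦ g(U, J)`, `B′ ↦ R(u)B′` with `R(u)` a continuous linear
automorphism; consequently the quadratic term `½⟨Q(Y, B)B, B⟩ = coeff140 (F a) B B B` and `V″ = V −` it are invariant
(`Inv.map₂`). [cite: Balaban1988RG2Cluster, Lemma 2 (1.42) p.11] -/
theorem coeff140_inv {F' : 𝔘 → E → F} (iso : E ≃L[ℂ] E) (hF : Inv g iso F') (a : 𝔘) (B u v : E) :
    coeff140 (F' (g a)) (iso B) (iso u) (iso v) = coeff140 (F' a) B u v := by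
  have h : F' (g a) ∘ ⇑iso = F' a := funext fun w => hF a w
  rw [← coeff140_comp_equiv, h]

/-- The quadratic term of (1.42), `B ↦ coeff140 (F a) B B B` (= `½⟨Q(Y, B)B, B⟩` in the reading of `B13PkScaling`,
`Qop_apply_apply`), is a jointly invariant function. [cite: Balaban1988RG2Cluster, Lemma 2 (1.42) p.11] -/
theorem quadraticTerm_inv {F' : 𝔘 → E → F} (iso : E ≃L[ℂ] E) (hF : Inv g iso F') :
    Inv g iso (fun a B => coeff140 (F' a) B B B) := by
  intro a B
  exact coeff140_inv iso hF a B B B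

/-- … hence so is the other term of (1.42), `V″ = V − (quadratic term)`. [cite: Balaban1988RG2Cluster, Lemma 2 (1.42) p.11] -/
theorem secondTerm_inv {F' : 𝔘 → E → F} (iso : E ≃L[ℂ] E) (hF : Inv g iso F') :
    Inv g iso (fun a B => F' a B - coeff140 (F' a) B B B) :=
  Inv.map₂ hF (quadraticTerm_inv iso hF) (· - ·)

end Taylor

/-! ## §F. (v1.1, APPEND-ONLY) The inverse device: Green's functions and resolvents -/

section Inverse

variable {𝔘 Φ : Type*} {g : 𝔘 → 𝔘} {ρ : Φ → Φ}

/-- Device D6′ (*«we denote its inverse again by G, or G(U)»*, (3.27) [13]; `G(Uᵘ) = R(u)G(U)R(u⁻¹)` (3.34)): if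
`T(U)` is covariant and `S(U)` is its two-sided inverse for every `U`, then `S` is covariant.  Nothing is assumed on
`ρ`. [cite: Balaban1985BackgroundPropagators, (3.27), (3.34) p.395–396] -/
theorem Cov.inverse {T S : 𝔘 → Φ → Φ} (hT : Cov g ρ T) (hleft : ∀ U φ, S U (T U φ) = φ)
    (hright : ∀ U φ, T U (S U φ) = φ) : Cov g ρ S := by
  intro U φ
  conv_lhs => rw [← hright U φ, ← hT U (S U φ)]
  rw [hleft]

variable {𝕜 : Type*} [Semiring 𝕜] [AddCommMonoid Φ] [Module 𝕜 Φ]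

/-- The scalar shift `xI + T(U)` of a covariant family is covariant (`R(u)` linear) — the operators `xI + C*Δ_kC` of
(2.7) p. 13. [folklore] -/
theorem Cov.shift (ρ : Φ →ₗ[𝕜] Φ) {T : 𝔘 → Φ → Φ} (hT : Cov g ρ T) (x : 𝕜) :
    Cov g ρ (fun U φ => x • φ + T U φ) :=
  Cov.add ρ (Cov.smul ρ (T := fun _ => id) (fun _ _ => rfl) x) hT

/-- **The resolvent device of (2.7) p. 13**: a two-sided inverse `S(U)` of `xI + T(U)` (the resolvent
`(xI + C*Δ_kC)⁻¹`) of a covariant family is covariant; with `Cov.paramOp` (the `dx`-integral commuting with the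
continuous linear `R(u)`) the square root `(C^{(k)})^{1/2} = (1/π)∫₀^∞ dx x^{-1/2}(xI + C*Δ_kC)⁻¹` is then covariant —
the integral's commutation with `R(u)` being that lemma's hypothesis `hΛ`. [cite: Balaban1988RG2Cluster, (2.7) p.13] -/
theorem Cov.resolvent (ρ : Φ →ₗ[𝕜] Φ) {T S : 𝔘 → Φ → Φ} (hT : Cov g ρ T) (x : 𝕜)
    (hleft : ∀ U φ, S U (x • φ + T U φ) = φ) (hright : ∀ U φ, x • S U φ + T U (S U φ) = φ) :
    Cov g ρ S :=
  Cov.inverse (Cov.shift ρ hT x) hleft hright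

end Inverse

/-! ## §G. (v1.2, APPEND-ONLY) The neighbourhood / domain clause: `Gᶜ`-valued `u` near `G`

[II] p. 11 Lemma 2 states the invariance *«for Gᶜ-valued transformations u in a sufficiently small neighborhood of all
G-valued transformations»*, and [I] p. 276 explains the proviso: *«so that the configurations after the
transformations belong to proper spaces also.»* — the transformed variables must stay inside the DOMAINS on which the
constructions are made; in the PRECEDING paragraph of [I] p. 276 — about the specific transformations `v`, `u_{k+1}` of
(3.26)–(3.28) applied to `J, B` inside `𝐇_k(B′)` (*«Thus in the function 𝐇_k(B′) the variables J, B are replaced by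
R(u_{k+1}⁻¹)R(v⁻¹)J, R(u_{k+1}⁻¹)R(v⁻¹)B.»*), not as a gloss on the (3.29) proviso (attribution DOCFIX C-pv08g4-5) — the
print has *«First, there are the bounds in (3.26), (3.27) for v, u_{k+1}. They imply that the above expressions have
almost the same bounds as J, B.»*: the same near-identity ⇒ near-isometry mechanism, whence the locus of §G.2's
nested-ball bookkeeping.  For the fixed-point device
D8 the domain is printed on [II] p. 5: *«consider this equation on the space of functions satisfying |A′| < ε₂»*, the
transformation *«maps the domain {X:|X| < 4C₂ε₂²} into itself. We prove similarly that it is contractive on this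
domain, hence the fixed point is an analytic function of A′, s(Y₀), bounded by 4C₂ε₂². Because ε₂ can be chosen
arbitrarily close to |A′|, so we have the inequality |D(H(s(Y₀)), A′)| ≦ 4C₂|A′|². (1.14)»*.

WHAT §G TYPES (device D11 of the companion census; residual (ii) of GAPS C-B13-36).  §D's `fixedPoint_cov` asks
`MapsTo ρ K K` — automatic for the ISOMETRIC `R(u)` of a `G`-valued `u`, but false in general for a `Gᶜ`-valued one,
whose action is only NEAR-isometric, `‖R(u)X‖ ≤ M‖X‖` with `M ≥ 1` (`M = ‖u‖‖u⁻¹‖` for the adjoint-type action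
(3.28) [13], `norm_conj_le`; `M = 1` for unitary `u`, `norm_conj_unitary`).  §G.1 isolates what the one-line
uniqueness argument really consumes — only that the IMAGE `R(u)X` of the solution lies in the uniqueness domain at the
transformed datum (`fixedPoint_cov_of_image`, `fixedPoint_cov₂_on`); §G.2 is the nested-ball bookkeeping *«almost the
same bounds»* (`mapsTo_ball_div_of_norm_le`, `norm_fibrewise_le`, …); §G.3 DISCHARGES device D8 over the kernel
fixed point of `B13Contraction113` (the solution map `solD` of (1.13)): by (1.14), `‖R(u)D(H(U), A′)‖ ≤ M·4C₂|A′|²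
≤ 4C₂ε₂²` as soon as `|A′| < ε₂/M`, so `R(u)D(H(U), A′)` lies in the uniqueness ball at the transformed datum
`R(u)A′` (of norm `< ε₂`), whence `D(H(Uᵘ), R(u)A′) = R(u)D(H(U), A′)` on `|A′| < ε₂/M` (`solD_cov`; `M = 1`: the
full printed domain, `solD_cov_of_norm_le_one`).  The price of a `Gᶜ`-valued `u` is exactly the factor `M` in the radius —
the typed content of *«sufficiently small neighborhood»* for this device.  HYPOTHESES, as in §D: the two-space
covariance of `C(U)` and `H(U)` (`CovWith`), i.e. the transformation laws of the operators of [15], and the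
`U`-uniform constants `C₂, R, B₀e^{16κ₁}` of `QuadAnalytic` / `‖H‖`; nothing printed is asserted. [folklore] -/

section Neighbourhood

open Metric

/-! ### §G.1  Two-space covariance; the fixed-point device with the exact domain hypothesis -/

section ExactDomain

variable {𝔘 Φ Ψ Ξ : Type*} {g : 𝔘 → 𝔘}

/-- Two-space covariance `T(Uᵘ)R₁(u) = R₂(u)T(U)` for families of maps between DIFFERENT carriers — the operator
`H(s(Y₀))` from `X`-space to `A′`-space and the function `C` back, (1.3) p. 2 and (1.12)–(1.13) p. 5; `Cov g ρ T`
is `CovWith g ρ ρ T` (`cov_iff_covWith`). [folklore] -/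
def CovWith (g : 𝔘 → 𝔘) (ρ₁ : Φ → Φ) (ρ₂ : Ψ → Ψ) (T : 𝔘 → Φ → Ψ) : Prop :=
  ∀ U φ, T (g U) (ρ₁ φ) = ρ₂ (T U φ)

/-- `Cov` is the one-carrier case of `CovWith` (definitionally). [folklore] -/
theorem cov_iff_covWith {ρ : Φ → Φ} {T : 𝔘 → Φ → Φ} : Cov g ρ T ↔ CovWith g ρ ρ T := Iff.rfl

/-- Two-space covariance composes. [folklore] -/
theorem CovWith.comp {ρ₁ : Φ → Φ} {ρ₂ : Ψ → Ψ} {ρ₃ : Ξ → Ξ} {T₁ : 𝔘 → Ψ → Ξ} {T₂ : 𝔘 → Φ → Ψ}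
    (h₁ : CovWith g ρ₂ ρ₃ T₁) (h₂ : CovWith g ρ₁ ρ₂ T₂) :
    CovWith g ρ₁ ρ₃ (fun U φ => T₁ U (T₂ U φ)) := by
  intro U φ
  show T₁ (g U) (T₂ (g U) (ρ₁ φ)) = ρ₃ (T₁ U (T₂ U φ))
  rw [h₂ U φ, h₁ U (T₂ U φ)]

/-- The (1.13)-map `(a, X) ↦ C(U)(a − H(U)X)` is jointly covariant — `C(Uᵘ)(R′a − H(Uᵘ)R X) = R(C(U)(a − H(U)X))`
— when `C`, `H` are two-space covariant and `R′ = R(u)` on `A′`-space respects differences. [folklore] -/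
theorem cov_map113 [Sub Ψ] {ρ : Φ → Φ} {ρ' : Ψ → Ψ} {C : 𝔘 → Ψ → Φ} {H : 𝔘 → Φ → Ψ}
    (hC : CovWith g ρ' ρ C) (hH : CovWith g ρ ρ' H) (hsub : ∀ y₁ y₂, ρ' (y₁ - y₂) = ρ' y₁ - ρ' y₂)
    (U : 𝔘) (a : Ψ) (X : Φ) : C (g U) (ρ' a - H (g U) (ρ X)) = ρ (C U (a - H U X)) := by
  rw [hH U X, ← hsub, hC U]

variable {ρ : Φ → Φ}

/-- Device D8 with the EXACT domain hypothesis: §D's `fixedPoint_cov` uses `MapsTo ρ K K` only through the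
membership `ρ (S U) ∈ K` of the IMAGE OF THE SOLUTION in the uniqueness domain; this is that lemma with the weaker
hypothesis — the form a near-isometric `R(u)` (`Gᶜ`-valued `u`) can meet, §G.3. [folklore] -/
theorem fixedPoint_cov_of_image {T : 𝔘 → Φ → Φ} (hT : Cov g ρ T) {K : Set Φ} {S : 𝔘 → Φ}
    (hρS : ∀ U, ρ (S U) ∈ K) (hfix : ∀ U, T U (S U) = S U) (huniq : ∀ U x, x ∈ K → T U x = x → x = S U)
    (U : 𝔘) : S (g U) = ρ (S U) := by
  symm
  apply huniq (g U) (ρ (S U)) (hρS U)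
  rw [hT U (S U), hfix U]

/-- Device D8 with a datum `a` (the variable `A′` of `D(H, A′)`, *«on the space of functions satisfying |A′| < ε₂»*)
ranging over a DOMAIN `D` on which existence (`hfix`) and uniqueness in `K` (`huniq`) hold, and a smaller domain
`D' ⊆ D` mapped into `D` by `R′(u)` on which the image of the solution stays in `K`: the solution map is covariant
on `D'`.  (`fixedPoint_cov₂` of §D is the case `D = D' = univ`, `MapsTo ρ K K`.) [folklore] -/
theorem fixedPoint_cov₂_on {A : Type*} {ρ' : A → A} {T : 𝔘 → A → Φ → Φ}
    (hT : ∀ U a x, T (g U) (ρ' a) (ρ x) = ρ (T U a x)) {K : Set Φ} {D D' : Set A} (hD' : D' ⊆ D)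
    (hρ'D : MapsTo ρ' D' D) {S : 𝔘 → A → Φ} (hfix : ∀ U, ∀ a ∈ D, T U a (S U a) = S U a)
    (huniq : ∀ U, ∀ a ∈ D, ∀ x ∈ K, T U a x = x → x = S U a) (hρS : ∀ U, ∀ a ∈ D', ρ (S U a) ∈ K)
    (U : 𝔘) {a : A} (ha : a ∈ D') : S (g U) (ρ' a) = ρ (S U a) := by
  symm
  apply huniq (g U) (ρ' a) (hρ'D ha) (ρ (S U a)) (hρS U a ha)
  rw [hT U a (S U a), hfix U a (hD' ha)]

end ExactDomain

/-! ### §G.2  *«almost the same bounds»*: near-isometries and nested balls ([I] p. 276; device D11) -/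

section Balls

variable {Φ : Type*} [SeminormedAddCommGroup Φ] {ρ : Φ → Φ} {M : ℝ}

/-- A near-isometry `‖ρ x‖ ≤ M‖x‖` maps the closed ball of radius `r` into the one of radius `M r`. [folklore] -/
theorem mapsTo_closedBall_of_norm_le (hρ : ∀ x, ‖ρ x‖ ≤ M * ‖x‖) (hM : 0 ≤ M) (r : ℝ) :
    MapsTo ρ (closedBall (0:Φ) r) (closedBall (0:Φ) (M * r)) := by
  intro x hx
  rw [mem_closedBall, dist_zero_right] at hx ⊢
  exact (hρ x).trans (mul_le_mul_of_nonneg_left hx hM)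

/-- … hence the SHRUNKEN ball of radius `r/M` into the ball of radius `r`: the transformed datum `R(u)A′` satisfies
the printed `|·| < ε₂` as soon as `|A′| < ε₂/M`. [folklore] -/
theorem mapsTo_ball_div_of_norm_le (hρ : ∀ x, ‖ρ x‖ ≤ M * ‖x‖) (hM : 0 < M) (r : ℝ) :
    MapsTo ρ (ball (0:Φ) (r / M)) (ball (0:Φ) r) := by
  intro x hx
  rw [mem_ball, dist_zero_right] at hx ⊢
  calc ‖ρ x‖ ≤ M * ‖x‖ := hρ x
    _ < M * (r / M) := mul_lt_mul_of_pos_left hx hM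
    _ = r := mul_div_cancel₀ r hM.ne'

/-- The isometric case (`G`-valued `u`): every ball around `0` is mapped into itself — §D's hypothesis
`MapsTo ρ K K` for `K` a ball. [folklore] -/
theorem mapsTo_closedBall_of_norm_eq (hρ : ∀ x, ‖ρ x‖ = ‖x‖) (r : ℝ) :
    MapsTo ρ (closedBall (0:Φ) r) (closedBall (0:Φ) r) := by
  intro x hx
  rw [mem_closedBall, dist_zero_right] at hx ⊢
  exact (hρ x).le.trans hx

/-- … and every open ball around `0` (the printed domains `|A′| < ε₂`, `|X| < 4C₂ε₂²` are open). [folklore] -/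
theorem mapsTo_ball_of_norm_eq (hρ : ∀ x, ‖ρ x‖ = ‖x‖) (r : ℝ) : MapsTo ρ (ball (0:Φ) r) (ball (0:Φ) r) := by
  intro x hx
  rw [mem_ball, dist_zero_right] at hx ⊢
  exact (hρ x).trans_lt hx

end Balls

section Fibrewise

variable {𝕜 ι V : Type*} [Semiring 𝕜] [Fintype ι] [SeminormedAddCommGroup V] [Module 𝕜 V]

/-- Fibrewise near-isometries are near-isometries of the lattice field space in the sup norm: if every `R(u(x))` has
`‖R(u(x))v‖ ≤ M‖v‖` then `‖R(u)B‖ ≤ M‖B‖` (*«(R(u)U′)(x, x′) = R(u(x))U′(x, x′)»* (3.28) [13]; *«almost the same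
bounds as J, B»* [I] p. 276). [folklore] -/
theorem norm_fibrewise_le (r : ι → V →ₗ[𝕜] V) {M : ℝ} (hM : 0 ≤ M) (hr : ∀ i v, ‖r i v‖ ≤ M * ‖v‖)
    (φ : ι → V) : ‖fibrewise r φ‖ ≤ M * ‖φ‖ := by
  refine (pi_norm_le_iff_of_nonneg (mul_nonneg hM (norm_nonneg _))).2 fun i => ?_
  exact (hr i (φ i)).trans (mul_le_mul_of_nonneg_left (norm_le_pi_norm φ i) hM)

/-- Fibrewise isometries (`G`-valued `u`: orthogonal adjoint action) are isometries in the sup norm. [folklore] -/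
theorem norm_fibrewise_eq (r : ι → V →ₗ[𝕜] V) (hr : ∀ i v, ‖r i v‖ = ‖v‖) (φ : ι → V) :
    ‖fibrewise r φ‖ = ‖φ‖ := by
  apply le_antisymm
  · simpa using norm_fibrewise_le r zero_le_one (fun i v => by rw [hr i v, one_mul]) φ
  · refine (pi_norm_le_iff_of_nonneg (norm_nonneg _)).2 fun i => ?_
    rw [← hr i (φ i)]
    exact norm_le_pi_norm (fibrewise r φ) i

end Fibrewise

section Conj

variable {𝔸 : Type*} [NormedRing 𝔸]

/-- The dictionary for `M`: the adjoint-type action `X ↦ u X u⁻¹` of (3.28) [13] (*«Uᵘ(x, x′) =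
u(x)U(x, x′)u⁻¹(x′)»*) by a `Gᶜ`-valued `u` is bounded by `‖u‖‖u⁻¹‖`. [folklore] -/
theorem norm_conj_le (u w X : 𝔸) : ‖u * X * w‖ ≤ (‖u‖ * ‖w‖) * ‖X‖ := by
  calc ‖u * X * w‖ ≤ ‖u * X‖ * ‖w‖ := norm_mul_le _ _
    _ ≤ (‖u‖ * ‖X‖) * ‖w‖ := mul_le_mul_of_nonneg_right (norm_mul_le _ _) (norm_nonneg _)
    _ = (‖u‖ * ‖w‖) * ‖X‖ := by ring

/-- … and `M = ‖u‖‖u⁻¹‖ ≥ 1`. [folklore] -/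
theorem one_le_norm_mul_norm_inv [NormOneClass 𝔸] (u : 𝔸ˣ) : 1 ≤ ‖(u : 𝔸)‖ * ‖(↑u⁻¹ : 𝔸)‖ := by
  calc (1:ℝ) = ‖(1:𝔸)‖ := norm_one.symm
    _ = ‖(u : 𝔸) * ↑u⁻¹‖ := by rw [Units.mul_inv]
    _ ≤ ‖(u : 𝔸)‖ * ‖(↑u⁻¹ : 𝔸)‖ := norm_mul_le _ _

variable [StarRing 𝔸] [CStarRing 𝔸]

/-- For a unitary (`G`-valued) `u` the action is isometric, `M = 1` (C⋆-norm). [folklore] -/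
theorem norm_conj_unitary {u : 𝔸} (hu : u ∈ unitary 𝔸) (X : 𝔸) : ‖u * X * star u‖ = ‖X‖ := by
  rw [CStarRing.norm_mul_mem_unitary _ (Unitary.star_mem hu), CStarRing.norm_mem_unitary_mul _ hu]

end Conj

/-! ### §G.3  Device D8 DISCHARGED: the solution `D(H(U), A′)` of (1.13) is covariant on `|A′| < ε₂/M` -/

section SolD

open B13Contraction113 (QuadAnalytic exists_unique_fixedPoint bound_114)

variable {𝒳 𝒴 : Type*} [NormedAddCommGroup 𝒳] [NormedSpace ℂ 𝒳] [NormedAddCommGroup 𝒴] [NormedSpace ℂ 𝒴]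
  {𝔘 : Type*}

open scoped Classical in
/-- The solution map `(U, A′) ↦ D(H(U), A′)` of (1.13) p. 5 over `B13Contraction113`: THE fixed point of
`X ↦ C(U)(A′ − H(U)X)` in the closed ball `{|X| ≤ 4C₂ε₂²}` when one exists (it does and is unique for `|A′| < ε₂`,
`B13Contraction113.exists_unique_fixedPoint`), else `0`.  `C U`, `Hop U` = the function `C` and the operator
`H(s(Y₀))` built on the configuration `U` (their `U`-dependence is abstract). [cite: Balaban1988RG2Cluster, (1.13)–(1.14) p.5] -/
noncomputable def solD (C : 𝔘 → 𝒴 → 𝒳) (Hop : 𝔘 → 𝒳 →ₗ[ℂ] 𝒴) (C₂ ε : ℝ) (U : 𝔘) (a : 𝒴) : 𝒳 :=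
  if h : ∃ X ∈ closedBall (0:𝒳) (4 * C₂ * ε ^ 2), C U (a - Hop U X) = X then h.choose else 0

variable {C : 𝔘 → 𝒴 → 𝒳} {Hop : 𝔘 → 𝒳 →ₗ[ℂ] 𝒴} {C₂ R b ε : ℝ}

/-- Unfolding `solD` when a fixed point in the ball exists. [folklore] -/
theorem solD_eq_of_exists {U : 𝔘} {a : 𝒴} (h : ∃ X ∈ closedBall (0:𝒳) (4 * C₂ * ε ^ 2), C U (a - Hop U X) = X) :
    solD C Hop C₂ ε U a = h.choose := by
  rw [solD, dif_pos h]

variable [CompleteSpace 𝒳]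

/-- On the printed domain `|A′| < ε₂` (under the hypotheses of `B13Contraction113.exists_unique_fixedPoint`, uniform
in `U`), `solD` is a fixed point in the ball `4C₂ε₂²`. [cite: Balaban1988RG2Cluster, p.5 after (1.13)] -/
theorem solD_spec (hC : ∀ U, QuadAnalytic (C U) C₂ R) (hC₂ : 0 ≤ C₂) (hb : 0 ≤ b)
    (hHop : ∀ U X, ‖Hop U X‖ ≤ b * ‖X‖) (hq : 9 * C₂ * b * ε < 1) (hRC : 3 * ε ≤ R) (U : 𝔘) {a : 𝒴}
    (ha : ‖a‖ < ε) :
    solD C Hop C₂ ε U a ∈ closedBall (0:𝒳) (4 * C₂ * ε ^ 2) ∧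
      C U (a - Hop U (solD C Hop C₂ ε U a)) = solD C Hop C₂ ε U a := by
  have h : ∃ X ∈ closedBall (0:𝒳) (4 * C₂ * ε ^ 2), C U (a - Hop U X) = X := by
    obtain ⟨X, hX, hfix, -⟩ := exists_unique_fixedPoint (hC U) hC₂ hb (hHop U) ha hq hRC
    exact ⟨X, hX, hfix⟩
  rw [solD_eq_of_exists h]
  exact h.choose_spec

/-- Uniqueness in the ball ([II] p. 5 *«it is contractive on this domain»*): any fixed point in the ball `4C₂ε₂²` IS
`solD`. [cite: Balaban1988RG2Cluster, p.5 after (1.13)] -/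
theorem eq_solD_of_fix (hC : ∀ U, QuadAnalytic (C U) C₂ R) (hC₂ : 0 ≤ C₂) (hb : 0 ≤ b)
    (hHop : ∀ U X, ‖Hop U X‖ ≤ b * ‖X‖) (hq : 9 * C₂ * b * ε < 1) (hRC : 3 * ε ≤ R) (U : 𝔘) {a : 𝒴}
    (ha : ‖a‖ < ε) {X : 𝒳} (hX : X ∈ closedBall (0:𝒳) (4 * C₂ * ε ^ 2)) (hfix : C U (a - Hop U X) = X) :
    X = solD C Hop C₂ ε U a := by
  obtain ⟨X₀, -, -, huniq⟩ := exists_unique_fixedPoint (hC U) hC₂ hb (hHop U) ha hq hRC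
  obtain ⟨hmem, hfixD⟩ := solD_spec hC hC₂ hb hHop hq hRC U ha
  rw [huniq X hX hfix, huniq _ hmem hfixD]

/-- (1.14) for the solution map: `|D(H(U), A′)| ≤ 4C₂|A′|²` (`B13Contraction113.bound_114`).
[cite: Balaban1988RG2Cluster, (1.14) p.5] -/
theorem norm_solD_le (hC : ∀ U, QuadAnalytic (C U) C₂ R) (hC₂ : 0 ≤ C₂) (hb : 0 ≤ b)
    (hHop : ∀ U X, ‖Hop U X‖ ≤ b * ‖X‖) (hq : 9 * C₂ * b * ε < 1) (hRC : 3 * ε ≤ R) (U : 𝔘) {a : 𝒴}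
    (ha : ‖a‖ < ε) : ‖solD C Hop C₂ ε U a‖ ≤ 4 * C₂ * ‖a‖ ^ 2 := by
  obtain ⟨hmem, hfixD⟩ := solD_spec hC hC₂ hb hHop hq hRC U ha
  exact bound_114 (hC U) hC₂ hb (hHop U) ha hq hRC hmem hfixD

/-- **Device D8 discharged — the neighbourhood clause.**  Let `C(U)`, `H(U)` be two-space covariant under
`U ↦ Uᵘ`, `X ↦ R X`, `A′ ↦ R′A′` with `R′` respecting differences, and let `R`, `R′` be NEAR-isometries
`‖R X‖ ≤ M‖X‖`, `‖R′A′‖ ≤ M‖A′‖`, `M ≥ 1` (`Gᶜ`-valued `u` near `G`; `M = 1` for `G`-valued `u`).  Then on the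
shrunken domain `|A′| < ε₂/M` the solution of (1.13) is covariant: `D(H(Uᵘ), R′A′) = R D(H(U), A′)`.  Proof = the
print's two bounds: `|R′A′| < ε₂` (*«almost the same bounds»*), and by (1.14) `|R D| ≤ M·4C₂|A′|² ≤ 4C₂ε₂²`
since `M|A′|² ≤ (M|A′|)|A′| < ε₂·(ε₂/M) ≤ ε₂²`; so `R D(H(U), A′)` is a fixed point of the transformed map INSIDE
the uniqueness ball at the datum `R′A′`, and uniqueness (`eq_solD_of_fix`) concludes.  The constants `C₂, R, b, ε`
are the SAME for `U` and `Uᵘ` (*«belong to proper spaces also»*: `g` is a self-map of the space of admissible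
configurations, on which [15]'s constants are uniform — a hypothesis, as in §D).
[cite: Balaban1988RG2Cluster, Lemma 2 p.11; (1.13)–(1.14) p.5] [cite: Balaban1987RG1, (3.29) p.276] -/
theorem solD_cov {g : 𝔘 → 𝔘} {ρ : 𝒳 → 𝒳} {ρ' : 𝒴 → 𝒴} {M : ℝ} (hC : ∀ U, QuadAnalytic (C U) C₂ R)
    (hC₂ : 0 ≤ C₂) (hb : 0 ≤ b) (hHop : ∀ U X, ‖Hop U X‖ ≤ b * ‖X‖) (hq : 9 * C₂ * b * ε < 1)
    (hRC : 3 * ε ≤ R) (hCcov : CovWith g ρ' ρ C) (hHcov : CovWith g ρ ρ' fun U X => Hop U X)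
    (hsub : ∀ y₁ y₂, ρ' (y₁ - y₂) = ρ' y₁ - ρ' y₂) (hM : 1 ≤ M) (hρ : ∀ X, ‖ρ X‖ ≤ M * ‖X‖)
    (hρ' : ∀ y, ‖ρ' y‖ ≤ M * ‖y‖) (U : 𝔘) {a : 𝒴} (ha : ‖a‖ < ε / M) :
    solD C Hop C₂ ε (g U) (ρ' a) = ρ (solD C Hop C₂ ε U a) := by
  have hM0 : 0 < M := lt_of_lt_of_le one_pos hM
  have hMa : M * ‖a‖ < ε := by
    calc M * ‖a‖ < M * (ε / M) := mul_lt_mul_of_pos_left ha hM0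
      _ = ε := mul_div_cancel₀ ε hM0.ne'
  have ha1 : ‖a‖ ≤ M * ‖a‖ := le_mul_of_one_le_left (norm_nonneg _) hM
  have haε : ‖a‖ < ε := ha1.trans_lt hMa
  have hρa : ‖ρ' a‖ < ε := (hρ' a).trans_lt hMa
  obtain ⟨-, hXfix⟩ := solD_spec hC hC₂ hb hHop hq hRC U haε
  have hXle := norm_solD_le hC hC₂ hb hHop hq hRC U haε
  set X := solD C Hop C₂ ε U a with hXdef
  -- the image `ρ X` lies in the uniqueness ball at the transformed datum
  have hMa2 : M * ‖a‖ ^ 2 ≤ ε ^ 2 := by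
    nlinarith [mul_nonneg hM0.le (norm_nonneg a), norm_nonneg a]
  have hρX : ρ X ∈ closedBall (0:𝒳) (4 * C₂ * ε ^ 2) := by
    rw [mem_closedBall, dist_zero_right]
    calc ‖ρ X‖ ≤ M * ‖X‖ := hρ X
      _ ≤ M * (4 * C₂ * ‖a‖ ^ 2) := mul_le_mul_of_nonneg_left hXle hM0.le
      _ = 4 * C₂ * (M * ‖a‖ ^ 2) := by ring
      _ ≤ 4 * C₂ * ε ^ 2 := mul_le_mul_of_nonneg_left hMa2 (by positivity)
  -- and is a fixed point of the transformed map
  have hρfix : C (g U) (ρ' a - Hop (g U) (ρ X)) = ρ X := by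
    have h1 : Hop (g U) (ρ X) = ρ' (Hop U X) := hHcov U X
    rw [h1, ← hsub, hCcov U, hXfix]
  exact (eq_solD_of_fix hC hC₂ hb hHop hq hRC (g U) hρa hρX hρfix).symm

/-- The `G`-valued case `M = 1` (`R`, `R′` isometric or merely non-expanding): covariance of `D(H(·), ·)` on the
full printed domain `|A′| < ε₂` — §D's `fixedPoint_cov₂` with its hypotheses `MapsTo ρ K K`, `huniq` discharged.
[cite: Balaban1988RG2Cluster, Lemma 2 p.11; (1.13)–(1.14) p.5] -/
theorem solD_cov_of_norm_le_one {g : 𝔘 → 𝔘} {ρ : 𝒳 → 𝒳} {ρ' : 𝒴 → 𝒴} (hC : ∀ U, QuadAnalytic (C U) C₂ R)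
    (hC₂ : 0 ≤ C₂) (hb : 0 ≤ b) (hHop : ∀ U X, ‖Hop U X‖ ≤ b * ‖X‖) (hq : 9 * C₂ * b * ε < 1)
    (hRC : 3 * ε ≤ R) (hCcov : CovWith g ρ' ρ C) (hHcov : CovWith g ρ ρ' fun U X => Hop U X)
    (hsub : ∀ y₁ y₂, ρ' (y₁ - y₂) = ρ' y₁ - ρ' y₂) (hρ : ∀ X, ‖ρ X‖ ≤ ‖X‖) (hρ' : ∀ y, ‖ρ' y‖ ≤ ‖y‖)
    (U : 𝔘) {a : 𝒴} (ha : ‖a‖ < ε) : solD C Hop C₂ ε (g U) (ρ' a) = ρ (solD C Hop C₂ ε U a) :=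
  solD_cov hC hC₂ hb hHop hq hRC hCcov hHcov hsub le_rfl (fun X => by simpa using hρ X)
    (fun y => by simpa using hρ' y) U (by simpa using ha)

end SolD

end Neighbourhood

/-! ## §H. (v1.3, APPEND-ONLY) The Gaussian conditioning device of (2.5)–(2.6): conditioning on `Z₀ᶜ`, the
## completed square, the linear shift, the whitening `B′ = (C^{(k)})^{1/2}X`, and their transport under a
## block-orthogonal `R(u)` (device D5 of the companion census `G-B13-06-devices.md`)

[II] p. 12 (render `…-p012-x2.png`, READ AS IMAGE): *«The integrals above are represented in a similar way to (2.28)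
[6], namely as conditioning on Z₀ᶜ. Thus, we write the term corresponding to a domain Z₀ as
(Z^{(k)})⁻¹∫dB exp(−½⟨B, C\*Δ_kCB⟩)F(Z₀, B) = ∫dμ_{C^{(k)}}(B′) · [∫dB|_{Z₀} exp(−⟨Z₀ᶜB′, C\*Δ_kCZ₀B⟩ −
½⟨Z₀B, C\*Δ_kCZ₀B⟩)F(Z₀, B)] / [∫dB|_{Z₀} exp(−⟨Z₀ᶜB′, C\*Δ_kCZ₀B⟩ − ½⟨Z₀B, C\*Δ_kCZ₀B⟩)]
= ∫dμ_{C^{(k)}}(B′) exp(−½⟨Z₀ᶜB′, C\*Δ_kCC^{(k)}(Z₀)C\*Δ_kCZ₀ᶜB′⟩) · ∫dμ_{C^{(k)}(Z₀)}(B) exp(−⟨Z₀ᶜB′,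
C\*Δ_kCZ₀B⟩)F(Z₀, B). (2.5)  In the integral with respect to B′ we make the linear change of variables B′ =
(C^{(k)})^{1/2}X. This yields ∫dμ_{C^{(k)}}(B)F(Z₀, B) = Π_{b∈T₁^{(k)\*}} ∫ dX(b)e^{−½|X(b)|²}/(2π)^{½d(g)} ·
exp(−½⟨C\*Δ_kCZ₀ᶜ(C^{(k)})^{1/2}X, C^{(k)}(Z₀)C\*Δ_kCZ₀ᶜ(C^{(k)})^{1/2}X⟩)»* — p. 13 (render `…-p013-x2.png`) —
*«· ∫dμ_{C^{(k)}(Z₀)}(B) exp(−⟨B, C\*Δ_kCZ₀ᶜ(C^{(k)})^{1/2}X⟩)F(Z₀, B) = ∫dμ₀(X)G(Z₀, X, C^{(k)}(Z₀), (C^{(k)})^{1/2},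
Δ_k), (2.6) where the last equality is a definition of the function G, and the measure dμ₀.»*  The model [6] =
[Balaban1982Higgs2] (2.28) p. 563 is typed, with its completed square KERNEL-CHECKED, in `B2` (`B2.Display228`,
`B2.completeSquare228`), which this section imports and specialises (source `f = 0`).

THE MODEL (finite-dimensional, [folklore]; DIVERGENCE D-b13.29).  The bonds of `T₁^{(k)*}` inside `Z₀` are a finite
type `Λ`, those outside a finite type `C`; a field is `x : Λ → ℝ` (= `Z₀B`), `y : C → ℝ` (= `Z₀ᶜB′`), the pair
`p = (x, y)`; `dB` is Lebesgue measure (`volume`).  The positive operator `C*Δ_kC = (C^{(k)})⁻¹` is a real block matrix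
`A = Z₀C*Δ_kCZ₀ : Matrix Λ Λ ℝ` (symmetric, invertible where said), `B = Z₀C*Δ_kCZ₀ᶜ : Matrix Λ C ℝ` (so `Z₀ᶜC*Δ_kCZ₀ =
Bᵀ`), `D : Matrix C C ℝ`; hence `C^{(k)}(Z₀) = A⁻¹` (the inverse of the compression, (3.27) [13] / §F), the source seen
by the `Z₀`-integral is `j = By` (print's `⟨Z₀ᶜB′, C*Δ_kCZ₀B⟩` is `⟨y, Bᵀx⟩ = ⟨By, x⟩`), `∫dμ_{C^{(k)}(Z₀)}` is the NORMALISED Gaussian mean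
`gaussMean A` of weight `gaussWeight A x = exp(−½⟨x, Ax⟩)`, and `dμ₀` of (2.6) is `gaussMean 1` (the product of the
normalised `dX(b)e^{−½|X(b)|²}/(2π)^{½d(g)}`).  Integrands are `E`-valued (`E` any real normed space) and every
identity below that carries no integrability hypothesis holds for ALL integrands, the two sides being the same junk
value when an integral diverges.

WHAT §H CERTIFIES, display by display.
(H.1) THE COMPLETED SQUARE of (2.5) = `B2.completeSquare228` at `f = 0`: `½⟨p, C*Δ_kCp⟩ = ½⟨x − μ(y), A(x − μ(y))⟩ +
  ½⟨y, S y⟩` with the conditional mean `μ(y) = condMean A B y = −A⁻¹By = −C^{(k)}(Z₀)(Z₀C*Δ_kCZ₀ᶜB′)` and the Schur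
  complement `S = schur A B D = D − BᵀA⁻¹B` (`condExponent_eq`); the energy of the mean is the printed sandwich,
  `⟨μ, Aμ⟩ = ⟨By, A⁻¹By⟩ = ⟨Z₀ᶜB′, C*Δ_kC C^{(k)}(Z₀) C*Δ_kC Z₀ᶜB′⟩` (`condMean_energy`, `sandwich_eq`).
(H.2) THE LINEAR SHIFT (translation invariance of `dB|_{Z₀}`, no hypothesis on the integrand): `∫dx e^{−⟨j,x⟩−½⟨x,Ax⟩}
  Ψ(x) = e^{½⟨j, A⁻¹j⟩} ∫dx e^{−½⟨x,Ax⟩} Ψ(x − A⁻¹j)` (`integral_linear_shift`).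
(H.3) THE SECOND EQUALITY OF (2.5) at fixed exterior field, junk-safe and with NO non-vanishing hypothesis:
  `[∫dx w]⁻¹ ∫dx w F = e^{−½⟨j, A⁻¹j⟩} · ∫dμ_{A⁻¹}(x) e^{−⟨j,x⟩}F(x)`, `w = e^{−⟨j,x⟩−½⟨x,Ax⟩}` (`ratio_25`).
(H.4) THE FIRST EQUALITY OF (2.5) (conditioning on `Z₀ᶜ` = iterated integration, the conditional density written as
  the printed ratio): `∫dp e^{−½⟨p,C*Δ_kCp⟩}F(p) = ∫dy [∫dx e^{−½⟨(x,y),C*Δ_kC(x,y)⟩}] · [∫dx w]⁻¹[∫dx w F(x, y)]`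
  under the two hypotheses the print has for free — integrability of `e^{−½⟨p,C*Δ_kCp⟩}F(p)` (Fubini) and `∫dx w ≠ 0`
  (a convergent Gaussian integral is positive) (`totalExpectation_25`); both sides carry the same factor `(Z^{(k)})⁻¹`
  in print, omitted.  With (H.3): `display_25`.
(H.5) THE WHITENING (2.6): for ANY `T` with `TᵀC*Δ_kCT = 1` (print: `T = (C^{(k)})^{1/2}`), `∫dμ₀(X) Φ(TX) =
  ∫dμ_{C^{(k)}}(B′) Φ(B′)` (`gaussMean_whiten`; the Jacobian `|det T|` cancels between numerator and normalisation —
  `integral_comp_mulVec` is the change of variables `∫dx Ψ(Tx) = |det T|⁻¹∫dx Ψ(x)` from Mathlib's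
  `Measure.map_linearMap_addHaar_pi_eq_smul_addHaar`).
(H.6) THE GAUGE TRANSPORT (what device D5 needs for Lemma 2's last clause).  For a `G`-valued `u` the fibrewise action
  `R(u)` is orthogonal and commutes with the restrictions `Z₀`, `Z₀ᶜ` (§B), i.e. it is block-orthogonal `R = (R₁, R₂)`,
  `R₁ᵀR₁ = 1`, `R₂ᵀR₂ = 1`, and the covariance *«Δ(Uᵘ) = R(u)Δ(U)R(u⁻¹)»* ((3.30)–(3.34) [13], HYPOTHESIS as in §A)
  reads blockwise `A ↦ R₁AR₁ᵀ, B ↦ R₁BR₂ᵀ, D ↦ R₂DR₂ᵀ`.  Then every object of (2.5)–(2.6) transforms as the print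
  uses: `C^{(k)}(Z₀) ↦ R₁C^{(k)}(Z₀)R₁ᵀ` (`inv_conj`), `μ(R₂y) = R₁μ(y)` (`condMean_conj`), `S ↦ R₂SR₂ᵀ`
  (`schur_conj`), the sandwich operator `BᵀA⁻¹B ↦ R₂(BᵀA⁻¹B)R₂ᵀ` (`sandwich_conj`), all quadratic / bilinear
  exponents are invariant (`quadForm_conj`, `crossForm_conj`, `dotProduct_conj`), Lebesgue measure is invariant
  (`integral_comp_mulVec_of_transpose_mul_self`, `|det R| = 1`: `abs_det_eq_one_of_transpose_mul_self`), hence the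
  normalised Gaussian means are covariant: `∫dμ_{(RARᵀ)⁻¹}(x)Ψ(x) = ∫dμ_{A⁻¹}(x)Ψ(Rx)` (`gaussMean_conj`), in §A's
  vocabulary `Inv g R Ψ → (∫dμ_{C(gU)} Ψ(gU) = ∫dμ_{C(U)} Ψ(U))` (`gaussMean_inv`), and `dμ₀` is rotation invariant
  (`gaussMean_one_conj`).
NOT CERTIFIED (hypotheses, exactly as the print uses them): the covariance of `C*Δ_kC(U)` and of `(C^{(k)})^{1/2}(U)`
under `u` (the latter is §F + §C applied to (2.7)); positivity of `C*Δ_kC` (only `IsUnit A.det` / `A.IsSymm` enter, where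
stated); nothing about (2.7)–(2.9). -/

section GaussCond

open Matrix

variable {Λ C : Type} [Fintype Λ] [Fintype C] [DecidableEq Λ]
variable {E : Type*} [NormedAddCommGroup E] [NormedSpace ℝ E]

/-! ### §H.1  The completed square of (2.5): conditional mean, Schur complement, the printed sandwich -/

/-- The conditional mean of `Z₀B` given `Z₀ᶜB′ = y`: `μ(y) = −A⁻¹By = −C^{(k)}(Z₀)(Z₀C*Δ_kCZ₀ᶜB′)` — the shift
`−A_Λ⁻¹Aφ↾_{Λᶜ}` of (2.28) [6] at `f = 0`. [cite: Balaban1988RG2Cluster, (2.5) p.12] -/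
noncomputable def condMean (A : Matrix Λ Λ ℝ) (B : Matrix Λ C ℝ) (y : C → ℝ) : Λ → ℝ := -(A⁻¹ *ᵥ (B *ᵥ y))

/-- The Schur complement `D − BᵀA⁻¹B`: the precision of the marginal law of `Z₀ᶜB′` under `dμ_{C^{(k)}}`. [folklore] -/
noncomputable def schur (A : Matrix Λ Λ ℝ) (B : Matrix Λ C ℝ) (D : Matrix C C ℝ) : Matrix C C ℝ := D - Bᵀ * A⁻¹ * B

/-- `Aμ(y) = −By`: the conditional mean solves the printed linear equation (2.28) [6] at `f = 0`. [folklore] -/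
theorem mulVec_condMean (A : Matrix Λ Λ ℝ) (B : Matrix Λ C ℝ) (hdet : IsUnit A.det) (y : C → ℝ) :
    A *ᵥ condMean A B y = -(B *ᵥ y) := by
  unfold condMean
  rw [mulVec_neg, mulVec_mulVec, mul_nonsing_inv _ hdet, one_mulVec]

omit [DecidableEq Λ] in
/-- `⟨Tx, w⟩ = ⟨x, Tᵀw⟩`. [folklore] -/
theorem mulVec_dotProduct_eq (T : Matrix Λ Λ ℝ) (x w : Λ → ℝ) : (T *ᵥ x) ⬝ᵥ w = x ⬝ᵥ (Tᵀ *ᵥ w) := by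
  rw [dotProduct_comm, dotProduct_transpose_mulVec]

/-- `⟨By, A⁻¹By⟩ = ⟨y, (BᵀA⁻¹B)y⟩`: the printed sandwich `⟨Z₀ᶜB′, C*Δ_kC C^{(k)}(Z₀) C*Δ_kC Z₀ᶜB′⟩` as a quadratic form
in the exterior field. [cite: Balaban1988RG2Cluster, (2.5) p.12] -/
theorem sandwich_eq (A : Matrix Λ Λ ℝ) (B : Matrix Λ C ℝ) (y : C → ℝ) :
    (B *ᵥ y) ⬝ᵥ (A⁻¹ *ᵥ (B *ᵥ y)) = y ⬝ᵥ ((Bᵀ * A⁻¹ * B) *ᵥ y) := by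
  rw [← mulVec_mulVec, ← mulVec_mulVec, dotProduct_transpose_mulVec, dotProduct_comm]

/-- The energy of the conditional mean is the printed sandwich: `⟨μ(y), Aμ(y)⟩ = ⟨By, A⁻¹By⟩`. [folklore] -/
theorem condMean_energy (A : Matrix Λ Λ ℝ) (B : Matrix Λ C ℝ) (hdet : IsUnit A.det) (y : C → ℝ) :
    condMean A B y ⬝ᵥ (A *ᵥ condMean A B y) = (B *ᵥ y) ⬝ᵥ (A⁻¹ *ᵥ (B *ᵥ y)) := by
  rw [mulVec_condMean A B hdet, condMean, neg_dotProduct, dotProduct_neg, neg_neg]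
  exact dotProduct_comm _ _

/-- **The completed square of (2.5)** (`B2.completeSquare228` at source `f = 0`, with its `x`-independent remainder
IDENTIFIED as the Schur form): `½⟨p, C*Δ_kCp⟩ = ½⟨x − μ(y), A(x − μ(y))⟩ + ½⟨y, (D − BᵀA⁻¹B)y⟩` for `p = (x, y)`,
`A` symmetric invertible.  Hence at fixed `Z₀ᶜB′ = y` the `dB|_{Z₀}`-integral is Gaussian with covariance `A⁻¹ =
C^{(k)}(Z₀)` centred at `μ(y)`, and the `B′`-marginal has precision the Schur complement.
[cite: Balaban1988RG2Cluster, (2.5) p.12][cite: Balaban1982Higgs2, (2.28) p.563] -/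
theorem condExponent_eq (A : Matrix Λ Λ ℝ) (B : Matrix Λ C ℝ) (D : Matrix C C ℝ) (hA : A.IsSymm)
    (hdet : IsUnit A.det) (x : Λ → ℝ) (y : C → ℝ) :
    (1 / 2) * (x ⬝ᵥ (A *ᵥ x) + x ⬝ᵥ (B *ᵥ y) + y ⬝ᵥ (Bᵀ *ᵥ x) + y ⬝ᵥ (D *ᵥ y))
      = (1 / 2) * ((x - condMean A B y) ⬝ᵥ (A *ᵥ (x - condMean A B y)))
        + (1 / 2) * (y ⬝ᵥ (schur A B D *ᵥ y)) := by
  have h := B2.completeSquare228 A B D hA 0 x (condMean A B y) 0 y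
    (by rw [mulVec_condMean A B hdet, zero_sub])
  simp only [zero_dotProduct, add_zero, sub_zero] at h
  have e1 : condMean A B y ⬝ᵥ (A *ᵥ condMean A B y) = y ⬝ᵥ ((Bᵀ * A⁻¹ * B) *ᵥ y) := by
    rw [condMean_energy A B hdet, sandwich_eq]
  have e2 : y ⬝ᵥ (schur A B D *ᵥ y) = y ⬝ᵥ (D *ᵥ y) - y ⬝ᵥ ((Bᵀ * A⁻¹ * B) *ᵥ y) := by
    rw [schur, sub_mulVec, dotProduct_sub]
  rw [e2, ← e1]
  linear_combination h

/-! ### §H.2  The Gaussian weight, integral and NORMALISED mean; the linear shift -/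

/-- The Gaussian weight `exp(−½⟨x, Ax⟩)` of `dμ_{A⁻¹}` before normalisation (`A = Z₀C*Δ_kCZ₀`, `A⁻¹ = C^{(k)}(Z₀)`;
`A = 1`: the weight of `dμ₀`). [folklore] -/
noncomputable def gaussWeight (A : Matrix Λ Λ ℝ) (x : Λ → ℝ) : ℝ := Real.exp (-(1 / 2 * (x ⬝ᵥ (A *ᵥ x))))

/-- `∫dx exp(−½⟨x, Ax⟩) Ψ(x)` (Lebesgue `dx` = `volume` on `Λ → ℝ`; Bochner integral, junk `0` if divergent). [folklore] -/
noncomputable def gaussInt (A : Matrix Λ Λ ℝ) (Ψ : (Λ → ℝ) → E) : E := ∫ x, gaussWeight A x • Ψ x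

/-- The normalisation `∫dx exp(−½⟨x, Ax⟩)` (print's `Z^{(k)}`-type constants). [folklore] -/
noncomputable def gaussNorm (A : Matrix Λ Λ ℝ) : ℝ := ∫ x, gaussWeight A x

/-- The NORMALISED Gaussian mean `∫dμ_{A⁻¹}(x)Ψ(x) = [∫dx e^{−½⟨x,Ax⟩}]⁻¹ ∫dx e^{−½⟨x,Ax⟩}Ψ(x)` — print's
`∫dμ_{C^{(k)}(Z₀)}(B)(·)` for `A⁻¹ = C^{(k)}(Z₀)`, and `∫dμ₀(X)(·)` for `A = 1`. [cite: Balaban1988RG2Cluster, (2.5)–(2.6) pp.12–13] -/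
noncomputable def gaussMean (A : Matrix Λ Λ ℝ) (Ψ : (Λ → ℝ) → E) : E := (gaussNorm A)⁻¹ • gaussInt A Ψ

omit [DecidableEq Λ] in
/-- The Gaussian integral of `1` is the normalisation. [folklore] -/
theorem gaussInt_one_eq_gaussNorm (A : Matrix Λ Λ ℝ) : gaussInt A (fun _ => (1 : ℝ)) = gaussNorm A := by
  simp only [gaussInt, gaussNorm, smul_eq_mul, mul_one]

/-- **The linear shift** behind (2.5) (translation invariance of `dB|_{Z₀}`, valid for EVERY integrand `Ψ`, no
measurability or integrability needed): for `A` symmetric invertible and any source `j`,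
`∫dx e^{−⟨j,x⟩−½⟨x,Ax⟩}Ψ(x) = e^{½⟨j,A⁻¹j⟩} ∫dx e^{−½⟨x,Ax⟩}Ψ(x − A⁻¹j)`. [folklore] -/
theorem integral_linear_shift (A : Matrix Λ Λ ℝ) (hA : A.IsSymm) (hdet : IsUnit A.det) (j : Λ → ℝ)
    (Ψ : (Λ → ℝ) → E) :
    ∫ x, Real.exp (-(j ⬝ᵥ x) - 1 / 2 * (x ⬝ᵥ (A *ᵥ x))) • Ψ x
      = Real.exp (1 / 2 * (j ⬝ᵥ (A⁻¹ *ᵥ j))) • gaussInt A (fun z => Ψ (z - A⁻¹ *ᵥ j)) := by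
  set m : Λ → ℝ := A⁻¹ *ᵥ j with hm
  have hAm : A *ᵥ m = j := by rw [hm, mulVec_mulVec, mul_nonsing_inv _ hdet, one_mulVec]
  have key : ∀ z : Λ → ℝ, -(j ⬝ᵥ (z - m)) - 1 / 2 * ((z - m) ⬝ᵥ (A *ᵥ (z - m)))
      = 1 / 2 * (j ⬝ᵥ m) + -(1 / 2 * (z ⬝ᵥ (A *ᵥ z))) := by
    intro z
    have h1 : (z - m) ⬝ᵥ (A *ᵥ (z - m))
        = z ⬝ᵥ (A *ᵥ z) - z ⬝ᵥ (A *ᵥ m) - (m ⬝ᵥ (A *ᵥ z) - m ⬝ᵥ (A *ᵥ m)) := by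
      rw [mulVec_sub, sub_dotProduct, dotProduct_sub, dotProduct_sub]
    have h2 : m ⬝ᵥ (A *ᵥ z) = z ⬝ᵥ (A *ᵥ m) := by
      have := dotProduct_transpose_mulVec A m z
      rwa [hA.eq] at this
    rw [h1, h2, hAm, dotProduct_sub, dotProduct_comm z j, dotProduct_comm m j]
    ring
  have htr := integral_sub_right_eq_self (μ := (volume : Measure (Λ → ℝ)))
    (fun x => Real.exp (-(j ⬝ᵥ x) - 1 / 2 * (x ⬝ᵥ (A *ᵥ x))) • Ψ x) m
  refine htr.symm.trans ?_
  show ∫ x, Real.exp (-(j ⬝ᵥ (x - m)) - 1 / 2 * ((x - m) ⬝ᵥ (A *ᵥ (x - m)))) • Ψ (x - m)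
    = Real.exp (1 / 2 * (j ⬝ᵥ m)) • ∫ x, gaussWeight A x • Ψ (x - m)
  simp_rw [key, Real.exp_add, mul_smul]
  rw [integral_smul]
  rfl

/-! ### §H.3  The second equality of (2.5): the printed ratio at fixed exterior field -/

/-- **(2.5), second equality, at fixed `Z₀ᶜB′`.**  With `w(x) = exp(−⟨j,x⟩ − ½⟨x,Ax⟩)` (`j = Z₀C*Δ_kCZ₀ᶜB′`, `A =
Z₀C*Δ_kCZ₀`, `A⁻¹ = C^{(k)}(Z₀)`): `[∫dx w]⁻¹ ∫dx w F = exp(−½⟨j, A⁻¹j⟩) · ∫dμ_{A⁻¹}(x) e^{−⟨j,x⟩}F(x)` — i.e.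
*«= … exp(−½⟨Z₀ᶜB′, C\*Δ_kCC^{(k)}(Z₀)C\*Δ_kCZ₀ᶜB′⟩) · ∫dμ_{C^{(k)}(Z₀)}(B) exp(−⟨Z₀ᶜB′, C\*Δ_kCZ₀B⟩)F(Z₀, B)»* with
the sandwich read through `sandwich_eq`.  NO hypothesis on `F` and NO non-vanishing hypothesis: both sides are the same
junk when the normalisation vanishes. [cite: Balaban1988RG2Cluster, (2.5) p.12] -/
theorem ratio_25 (A : Matrix Λ Λ ℝ) (hA : A.IsSymm) (hdet : IsUnit A.det) (j : Λ → ℝ) (F : (Λ → ℝ) → E) :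
    (∫ x, Real.exp (-(j ⬝ᵥ x) - 1 / 2 * (x ⬝ᵥ (A *ᵥ x))))⁻¹
        • ∫ x, Real.exp (-(j ⬝ᵥ x) - 1 / 2 * (x ⬝ᵥ (A *ᵥ x))) • F x
      = Real.exp (-(1 / 2 * (j ⬝ᵥ (A⁻¹ *ᵥ j)))) • gaussMean A (fun x => Real.exp (-(j ⬝ᵥ x)) • F x) := by
  have hD : ∫ x, Real.exp (-(j ⬝ᵥ x) - 1 / 2 * (x ⬝ᵥ (A *ᵥ x)))
      = Real.exp (1 / 2 * (j ⬝ᵥ (A⁻¹ *ᵥ j))) * gaussNorm A := by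
    have h := integral_linear_shift A hA hdet j (fun _ => (1 : ℝ))
    simp only [smul_eq_mul, mul_one] at h
    rw [h, gaussInt_one_eq_gaussNorm]
  have hN : ∫ x, Real.exp (-(j ⬝ᵥ x) - 1 / 2 * (x ⬝ᵥ (A *ᵥ x))) • F x
      = gaussInt A (fun x => Real.exp (-(j ⬝ᵥ x)) • F x) := by
    simp only [gaussInt, gaussWeight, smul_smul, ← Real.exp_add]
    congr 1; funext x; congr 2; ring
  rw [hD, hN, gaussMean, smul_smul, mul_inv, Real.exp_neg]

/-! ### §H.4  The first equality of (2.5): conditioning on `Z₀ᶜ` as iterated integration -/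

/-- `exp(−½⟨p, C*Δ_kCp⟩)` in the blocks `p = (Z₀B, Z₀ᶜB) = (x, y)`: the weight of `dμ_{C^{(k)}}` before normalisation.
[cite: Balaban1988RG2Cluster, (2.5) p.12] -/
noncomputable def jointWeight (A : Matrix Λ Λ ℝ) (B : Matrix Λ C ℝ) (D : Matrix C C ℝ) (p : (Λ → ℝ) × (C → ℝ)) : ℝ :=
  Real.exp (-(1 / 2 * (p.1 ⬝ᵥ (A *ᵥ p.1) + p.1 ⬝ᵥ (B *ᵥ p.2) + p.2 ⬝ᵥ (Bᵀ *ᵥ p.1) + p.2 ⬝ᵥ (D *ᵥ p.2))))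

/-- *«exp(−⟨Z₀ᶜB′, C\*Δ_kCZ₀B⟩ − ½⟨Z₀B, C\*Δ_kCZ₀B⟩)»*: the un-normalised conditional weight at exterior field `y`
(source `j = By`). [cite: Balaban1988RG2Cluster, (2.5) p.12] -/
noncomputable def condWeight (A : Matrix Λ Λ ℝ) (B : Matrix Λ C ℝ) (y : C → ℝ) (x : Λ → ℝ) : ℝ :=
  Real.exp (-((B *ᵥ y) ⬝ᵥ x) - 1 / 2 * (x ⬝ᵥ (A *ᵥ x)))

omit [DecidableEq Λ] in
/-- The joint weight factors through the conditional one: `e^{−½⟨p,C*Δ_kCp⟩} = e^{−½⟨y,Dy⟩} · w_y(x)`. [folklore] -/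
theorem jointWeight_eq (A : Matrix Λ Λ ℝ) (B : Matrix Λ C ℝ) (D : Matrix C C ℝ) (x : Λ → ℝ) (y : C → ℝ) :
    jointWeight A B D (x, y) = Real.exp (-(1 / 2 * (y ⬝ᵥ (D *ᵥ y)))) * condWeight A B y x := by
  rw [jointWeight, condWeight, ← Real.exp_add]
  dsimp only
  rw [dotProduct_transpose_mulVec B y x, dotProduct_comm (B *ᵥ y) x]
  congr 1; ring

omit [DecidableEq Λ] in
/-- **(2.5), first equality** (conditioning on `Z₀ᶜ`): `∫dp e^{−½⟨p,C*Δ_kCp⟩}F(p) = ∫dy [∫dx e^{−½⟨(x,y),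
C*Δ_kC(x,y)⟩}] · ([∫dx w_y]⁻¹ ∫dx w_y F(x, y))` — the outer integral is print's `∫dμ_{C^{(k)}}(B′)` (up to the common
factor `(Z^{(k)})⁻¹`, omitted on both sides; the bracket is the `B′`-marginal weight, the integrand depending on
`Z₀ᶜB′ = y` only), the inner ratio is print's quotient of `dB|_{Z₀}`-integrals.  HYPOTHESES, both automatic in print:
integrability of `e^{−½⟨p,C*Δ_kCp⟩}F` (Fubini) and non-vanishing of the denominators (convergent Gaussian integrals are
positive). [cite: Balaban1988RG2Cluster, (2.5) p.12] -/
theorem totalExpectation_25 (A : Matrix Λ Λ ℝ) (B : Matrix Λ C ℝ) (D : Matrix C C ℝ)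
    (F : (Λ → ℝ) × (C → ℝ) → E) (hF : Integrable (fun p => jointWeight A B D p • F p))
    (hden : ∀ y : C → ℝ, ∫ x, condWeight A B y x ≠ 0) :
    ∫ p, jointWeight A B D p • F p
      = ∫ y, (∫ x, jointWeight A B D (x, y))
          • ((∫ x, condWeight A B y x)⁻¹ • ∫ x, condWeight A B y x • F (x, y)) := by
  have hpt : ∀ y : C → ℝ, (∫ x, jointWeight A B D (x, y))
      • ((∫ x, condWeight A B y x)⁻¹ • ∫ x, condWeight A B y x • F (x, y))
        = ∫ x, jointWeight A B D (x, y) • F (x, y) := by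
    intro y
    simp_rw [jointWeight_eq]
    rw [integral_const_mul, smul_smul, mul_assoc, mul_inv_cancel₀ (hden y), mul_one, ← integral_smul]
    congr 1; funext x; rw [smul_smul]
  calc ∫ p, jointWeight A B D p • F p
      = ∫ y, ∫ x, jointWeight A B D (x, y) • F (x, y) := integral_prod_symm _ hF
    _ = _ := by congr 1; funext y; exact (hpt y).symm

/-- **(2.5) as printed** (both equalities): `∫dp e^{−½⟨p,C*Δ_kCp⟩}F(p) = ∫dy [B′-marginal weight] ·
exp(−½⟨By, A⁻¹By⟩) · ∫dμ_{A⁻¹}(x) e^{−⟨By,x⟩}F(x, y)`, under the hypotheses of `totalExpectation_25` and for `A`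
symmetric invertible. [cite: Balaban1988RG2Cluster, (2.5) p.12] -/
theorem display_25 (A : Matrix Λ Λ ℝ) (B : Matrix Λ C ℝ) (D : Matrix C C ℝ) (hA : A.IsSymm) (hdet : IsUnit A.det)
    (F : (Λ → ℝ) × (C → ℝ) → E) (hF : Integrable (fun p => jointWeight A B D p • F p))
    (hden : ∀ y : C → ℝ, ∫ x, condWeight A B y x ≠ 0) :
    ∫ p, jointWeight A B D p • F p
      = ∫ y, (∫ x, jointWeight A B D (x, y))
          • (Real.exp (-(1 / 2 * ((B *ᵥ y) ⬝ᵥ (A⁻¹ *ᵥ (B *ᵥ y)))))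
              • gaussMean A (fun x => Real.exp (-((B *ᵥ y) ⬝ᵥ x)) • F (x, y))) := by
  rw [totalExpectation_25 A B D F hF hden]
  congr 1; funext y; congr 1
  exact ratio_25 A hA hdet (B *ᵥ y) (fun x => F (x, y))

/-! ### §H.5  Linear changes of variables: the Jacobian identity, orthogonal invariance, the whitening (2.6) -/

/-- Change of variables in `dx` on `Λ → ℝ` by an invertible matrix: `∫dx Ψ(Tx) = |det T|⁻¹ ∫dx Ψ(x)`, for EVERY `Ψ`
(Mathlib's `Measure.map_linearMap_addHaar_pi_eq_smul_addHaar`). [folklore] -/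
theorem integral_comp_mulVec (T : Matrix Λ Λ ℝ) (hT : IsUnit T.det) (Ψ : (Λ → ℝ) → E) :
    ∫ x, Ψ (T *ᵥ x) = |T.det|⁻¹ • ∫ x, Ψ x := by
  have hdet : LinearMap.det (Matrix.toLin' T) ≠ 0 := by
    rw [LinearMap.det_toLin']; exact hT.ne_zero
  let L : (Λ → ℝ) ≃ₗ[ℝ] (Λ → ℝ) := T.toLinearEquiv' (T.invertibleOfIsUnitDet hT)
  let e : (Λ → ℝ) ≃ᵐ (Λ → ℝ) := L.toContinuousLinearEquiv.toHomeomorph.toMeasurableEquiv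
  have he : (e : (Λ → ℝ) → (Λ → ℝ)) = fun x => T *ᵥ x := by
    funext x
    exact Matrix.toLin'_apply T x
  have he' : (e : (Λ → ℝ) → (Λ → ℝ)) = (Matrix.toLin' T : (Λ → ℝ) → (Λ → ℝ)) := by
    rw [he]; funext x; exact (Matrix.toLin'_apply T x).symm
  calc ∫ x, Ψ (T *ᵥ x) = ∫ x, Ψ (e x) := by rw [he]
    _ = ∫ y, Ψ y ∂(Measure.map e volume) := (e.measurableEmbedding.integral_map Ψ).symm
    _ = ∫ y, Ψ y ∂(ENNReal.ofReal |(LinearMap.det (Matrix.toLin' T))⁻¹| • (volume : Measure (Λ → ℝ))) := by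
          rw [he', Measure.map_linearMap_addHaar_pi_eq_smul_addHaar hdet]
    _ = |T.det|⁻¹ • ∫ y, Ψ y := by
          rw [integral_smul_measure, ENNReal.toReal_ofReal (abs_nonneg _), LinearMap.det_toLin', abs_inv]

/-- An orthogonal matrix has `|det R| = 1`. [folklore] -/
theorem abs_det_eq_one_of_transpose_mul_self (R : Matrix Λ Λ ℝ) (hR : Rᵀ * R = 1) : |R.det| = 1 := by
  have h : R.det * R.det = 1 := by
    have := congrArg Matrix.det hR
    rwa [det_mul, det_transpose, det_one] at this
  rcases mul_self_eq_one_iff.mp h with h' | h' <;> simp [h']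

/-- An orthogonal matrix is invertible. [folklore] -/
theorem isUnit_det_of_transpose_mul_self (R : Matrix Λ Λ ℝ) (hR : Rᵀ * R = 1) : IsUnit R.det := by
  rw [isUnit_iff_ne_zero]
  intro h
  have h1 := abs_det_eq_one_of_transpose_mul_self R hR
  rw [h, abs_zero] at h1
  exact zero_ne_one h1

/-- `RᵀR = 1 → RRᵀ = 1` (square matrices). [folklore] -/
theorem mul_transpose_self_of_transpose_mul_self (R : Matrix Λ Λ ℝ) (hR : Rᵀ * R = 1) : R * Rᵀ = 1 := by
  have hinv : R⁻¹ = Rᵀ := inv_eq_left_inv hR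
  rw [← hinv]
  exact mul_nonsing_inv R (isUnit_det_of_transpose_mul_self R hR)

/-- Lebesgue measure `dB` is invariant under an orthogonal `R(u)`: `∫dx Ψ(Rx) = ∫dx Ψ(x)` for EVERY `Ψ`. [folklore] -/
theorem integral_comp_mulVec_of_transpose_mul_self (R : Matrix Λ Λ ℝ) (hR : Rᵀ * R = 1) (Ψ : (Λ → ℝ) → E) :
    ∫ x, Ψ (R *ᵥ x) = ∫ x, Ψ x := by
  rw [integral_comp_mulVec R (isUnit_det_of_transpose_mul_self R hR),
    abs_det_eq_one_of_transpose_mul_self R hR, inv_one, one_smul]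

omit [DecidableEq Λ] in
/-- `⟨Rx, Ry⟩ = ⟨x, RᵀRy⟩`. [folklore] -/
theorem mulVec_dotProduct_mulVec (R : Matrix Λ Λ ℝ) (x y : Λ → ℝ) :
    (R *ᵥ x) ⬝ᵥ (R *ᵥ y) = x ⬝ᵥ ((Rᵀ * R) *ᵥ y) := by
  rw [mulVec_dotProduct_eq, mulVec_mulVec]

/-- `⟨R(u)j, R(u)x⟩ = ⟨j, x⟩` for orthogonal `R(u)` (the linear exponents `⟨Z₀ᶜB′, C*Δ_kCZ₀B⟩`). [folklore] -/
theorem dotProduct_conj (R : Matrix Λ Λ ℝ) (hR : Rᵀ * R = 1) (j x : Λ → ℝ) :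
    (R *ᵥ j) ⬝ᵥ (R *ᵥ x) = j ⬝ᵥ x := by
  rw [mulVec_dotProduct_mulVec, hR, one_mulVec]

/-- `⟨Rx, (RARᵀ)Rx⟩ = ⟨x, Ax⟩`: the quadratic exponents are invariant ((3.30)–(3.31) [13] shape). [folklore] -/
theorem quadForm_conj (R A : Matrix Λ Λ ℝ) (hR : Rᵀ * R = 1) (x : Λ → ℝ) :
    (R *ᵥ x) ⬝ᵥ ((R * A * Rᵀ) *ᵥ (R *ᵥ x)) = x ⬝ᵥ (A *ᵥ x) := by
  rw [mulVec_mulVec, Matrix.mul_assoc (R * A) Rᵀ R, hR, Matrix.mul_one, ← mulVec_mulVec,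
    mulVec_dotProduct_mulVec, hR, one_mulVec]

/-- `⟨R₁x, (R₁BR₂ᵀ)R₂y⟩ = ⟨x, By⟩`: the cross exponent `⟨Z₀B, Z₀C*Δ_kCZ₀ᶜB′⟩` is invariant. [folklore] -/
theorem crossForm_conj [DecidableEq C] (R₁ : Matrix Λ Λ ℝ) (R₂ : Matrix C C ℝ) (B : Matrix Λ C ℝ) (hR₁ : R₁ᵀ * R₁ = 1)
    (hR₂ : R₂ᵀ * R₂ = 1) (x : Λ → ℝ) (y : C → ℝ) :
    (R₁ *ᵥ x) ⬝ᵥ ((R₁ * B * R₂ᵀ) *ᵥ (R₂ *ᵥ y)) = x ⬝ᵥ (B *ᵥ y) := by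
  rw [mulVec_mulVec, Matrix.mul_assoc (R₁ * B) R₂ᵀ R₂, hR₂, Matrix.mul_one, ← mulVec_mulVec,
    mulVec_dotProduct_eq, mulVec_mulVec, hR₁, one_mulVec]

/-- `Rᵀ(RX) = X` for orthogonal `R`. [folklore] -/
theorem transpose_mul_mul_cancel (R : Matrix Λ Λ ℝ) (hR : Rᵀ * R = 1) {m : Type*} (X : Matrix Λ m ℝ) :
    Rᵀ * (R * X) = X := by
  rw [← Matrix.mul_assoc, hR, Matrix.one_mul]

/-- `Rᵀ(Rx) = x` for orthogonal `R`. [folklore] -/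
theorem transpose_mulVec_mulVec_cancel (R : Matrix Λ Λ ℝ) (hR : Rᵀ * R = 1) (x : Λ → ℝ) :
    Rᵀ *ᵥ (R *ᵥ x) = x := by
  rw [mulVec_mulVec, hR, one_mulVec]

/-- The conditional covariance is covariant: `(R₁AR₁ᵀ)⁻¹ = R₁A⁻¹R₁ᵀ`, i.e. `C^{(k)}(Z₀)(Uᵘ) = R(u)C^{(k)}(Z₀)(U)R(u)ᵀ`
once `Z₀C*Δ_kCZ₀` is ((3.27), (3.34) [13] shape; cf. `Cov.inverse`, `Cov.compress`). [folklore] -/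
theorem inv_conj (R A : Matrix Λ Λ ℝ) (hR : Rᵀ * R = 1) (hA : IsUnit A.det) : (R * A * Rᵀ)⁻¹ = R * A⁻¹ * Rᵀ := by
  apply inv_eq_right_inv
  simp only [Matrix.mul_assoc]
  rw [transpose_mul_mul_cancel R hR, Matrix.mul_nonsing_inv_cancel_left A Rᵀ hA,
    mul_transpose_self_of_transpose_mul_self R hR]

variable {A : Matrix Λ Λ ℝ} {B : Matrix Λ C ℝ} {D : Matrix C C ℝ} {R₁ : Matrix Λ Λ ℝ} {R₂ : Matrix C C ℝ}

/-- The conditional mean is covariant: `μ′(R₂y) = R₁μ(y)` for the transformed blocks `A′ = R₁AR₁ᵀ, B′ = R₁BR₂ᵀ` —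
the shift of (2.5)/(2.28) commutes with `R(u)`. [folklore] -/
theorem condMean_conj [DecidableEq C] (hR₁ : R₁ᵀ * R₁ = 1) (hR₂ : R₂ᵀ * R₂ = 1) (hA : IsUnit A.det) (y : C → ℝ) :
    condMean (R₁ * A * R₁ᵀ) (R₁ * B * R₂ᵀ) (R₂ *ᵥ y) = R₁ *ᵥ condMean A B y := by
  unfold condMean
  rw [inv_conj R₁ A hR₁ hA]
  simp only [← mulVec_mulVec, mulVec_neg]
  rw [transpose_mulVec_mulVec_cancel R₂ hR₂, transpose_mulVec_mulVec_cancel R₁ hR₁]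

/-- The sandwich operator of (2.5) is covariant: `B′ᵀA′⁻¹B′ = R₂(BᵀA⁻¹B)R₂ᵀ`. [folklore] -/
theorem sandwich_conj (hR₁ : R₁ᵀ * R₁ = 1) (hA : IsUnit A.det) :
    (R₁ * B * R₂ᵀ)ᵀ * (R₁ * A * R₁ᵀ)⁻¹ * (R₁ * B * R₂ᵀ) = R₂ * (Bᵀ * A⁻¹ * B) * R₂ᵀ := by
  rw [inv_conj R₁ A hR₁ hA]
  simp only [transpose_mul, transpose_transpose, Matrix.mul_assoc, transpose_mul_mul_cancel R₁ hR₁]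

/-- The Schur complement (precision of the `B′`-marginal) is covariant: `S′ = R₂SR₂ᵀ`. [folklore] -/
theorem schur_conj (hR₁ : R₁ᵀ * R₁ = 1) (hA : IsUnit A.det) :
    schur (R₁ * A * R₁ᵀ) (R₁ * B * R₂ᵀ) (R₂ * D * R₂ᵀ) = R₂ * schur A B D * R₂ᵀ := by
  unfold schur
  rw [inv_conj R₁ A hR₁ hA]
  simp only [transpose_mul, transpose_transpose, Matrix.mul_sub, Matrix.sub_mul, Matrix.mul_assoc,
    transpose_mul_mul_cancel R₁ hR₁]

/-- The printed sandwich exponent `½⟨Z₀ᶜB′, C*Δ_kC C^{(k)}(Z₀) C*Δ_kC Z₀ᶜB′⟩` is invariant under `B′ ↦ R(u)B′`,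
`U ↦ Uᵘ`. [folklore] -/
theorem sandwich_inv [DecidableEq C] (hR₁ : R₁ᵀ * R₁ = 1) (hR₂ : R₂ᵀ * R₂ = 1) (hA : IsUnit A.det) (y : C → ℝ) :
    ((R₁ * B * R₂ᵀ) *ᵥ (R₂ *ᵥ y)) ⬝ᵥ ((R₁ * A * R₁ᵀ)⁻¹ *ᵥ ((R₁ * B * R₂ᵀ) *ᵥ (R₂ *ᵥ y)))
      = (B *ᵥ y) ⬝ᵥ (A⁻¹ *ᵥ (B *ᵥ y)) := by
  rw [sandwich_eq, sandwich_eq, sandwich_conj hR₁ hA, quadForm_conj R₂ _ hR₂]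

/-! ### §H.6  Covariance of the normalised Gaussian means; the whitening (2.6) -/

/-- The Gaussian weight is invariant: `e^{−½⟨Rx,(RARᵀ)Rx⟩} = e^{−½⟨x,Ax⟩}`. [folklore] -/
theorem gaussWeight_conj (R A : Matrix Λ Λ ℝ) (hR : Rᵀ * R = 1) (x : Λ → ℝ) :
    gaussWeight (R * A * Rᵀ) (R *ᵥ x) = gaussWeight A x := by
  unfold gaussWeight
  rw [quadForm_conj R A hR]

/-- `∫dx e^{−½⟨x,(RARᵀ)x⟩}Ψ(x) = ∫dx e^{−½⟨x,Ax⟩}Ψ(Rx)` for orthogonal `R`, EVERY `Ψ`. [folklore] -/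
theorem gaussInt_conj (R A : Matrix Λ Λ ℝ) (hR : Rᵀ * R = 1) (Ψ : (Λ → ℝ) → E) :
    gaussInt (R * A * Rᵀ) Ψ = gaussInt A (fun x => Ψ (R *ᵥ x)) := by
  have h := integral_comp_mulVec_of_transpose_mul_self R hR (fun x => gaussWeight (R * A * Rᵀ) x • Ψ x)
  unfold gaussInt
  refine h.symm.trans ?_
  congr 1; funext x
  simp only [gaussWeight_conj R A hR]

/-- The normalisations agree: `∫dx e^{−½⟨x,(RARᵀ)x⟩} = ∫dx e^{−½⟨x,Ax⟩}` for orthogonal `R`. [folklore] -/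
theorem gaussNorm_conj (R A : Matrix Λ Λ ℝ) (hR : Rᵀ * R = 1) : gaussNorm (R * A * Rᵀ) = gaussNorm A := by
  have h := integral_comp_mulVec_of_transpose_mul_self R hR (fun x => gaussWeight (R * A * Rᵀ) x)
  unfold gaussNorm
  refine h.symm.trans ?_
  congr 1; funext x
  simp only [gaussWeight_conj R A hR]

/-- **Covariance of the conditional Gaussian mean**: `∫dμ_{(RARᵀ)⁻¹}(x)Ψ(x) = ∫dμ_{A⁻¹}(x)Ψ(Rx)` for orthogonal
`R`, EVERY `Ψ` — with `inv_conj`: `∫dμ_{C^{(k)}(Z₀)(Uᵘ)}(B)Ψ(B) = ∫dμ_{C^{(k)}(Z₀)(U)}(B)Ψ(R(u)B)`. [folklore] -/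
theorem gaussMean_conj (R A : Matrix Λ Λ ℝ) (hR : Rᵀ * R = 1) (Ψ : (Λ → ℝ) → E) :
    gaussMean (R * A * Rᵀ) Ψ = gaussMean A (fun x => Ψ (R *ᵥ x)) := by
  unfold gaussMean
  rw [gaussNorm_conj R A hR, gaussInt_conj R A hR]

/-- `dμ₀` is rotation invariant: `∫dμ₀(X)Ψ(RX) = ∫dμ₀(X)Ψ(X)`. [folklore] -/
theorem gaussMean_one_conj (R : Matrix Λ Λ ℝ) (hR : Rᵀ * R = 1) (Ψ : (Λ → ℝ) → E) :
    gaussMean (1 : Matrix Λ Λ ℝ) (fun x => Ψ (R *ᵥ x)) = gaussMean 1 Ψ := by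
  have h := gaussMean_conj R 1 hR Ψ
  rw [Matrix.mul_one, mul_transpose_self_of_transpose_mul_self R hR] at h
  exact h.symm

/-- **Device D5 in §A's vocabulary.**  If the precision is covariant, `A(gU) = R A(U) Rᵀ` (HYPOTHESIS: the
transformation law of `Z₀C*Δ_kCZ₀`, (3.30)–(3.34) [13] with §B's `Cov.compress`), `R` is orthogonal, and the integrand
is jointly invariant, `Ψ(gU)(Rx) = Ψ(U)(x)` (`Inv g R Ψ`), then the conditional Gaussian mean is an invariant function
of `U`: `∫dμ_{C(gU)}Ψ(gU) = ∫dμ_{C(U)}Ψ(U)`. [cite: Balaban1988RG2Cluster, Lemma 2 p.11 with (2.5) p.12] -/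
theorem gaussMean_inv {𝔘 : Type*} {g : 𝔘 → 𝔘} (R : Matrix Λ Λ ℝ) (hR : Rᵀ * R = 1) {Aop : 𝔘 → Matrix Λ Λ ℝ}
    (hA : ∀ U, Aop (g U) = R * Aop U * Rᵀ) {Ψ : 𝔘 → (Λ → ℝ) → E} (hΨ : Inv g (fun x => R *ᵥ x) Ψ) (U : 𝔘) :
    gaussMean (Aop (g U)) (Ψ (g U)) = gaussMean (Aop U) (Ψ U) := by
  rw [hA, gaussMean_conj R _ hR]
  congr 1; funext x
  exact hΨ U x

/-- **The whitening (2.6)**: for ANY `T` with `TᵀAT = 1` (print: `T = (C^{(k)})^{1/2} = A^{−1/2}` on the whole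
lattice), `∫dμ₀(X)Φ(TX) = ∫dμ_{A⁻¹}(B′)Φ(B′)`, EVERY `Φ` — *«In the integral with respect to B′ we make the linear change
of variables B′ = (C^{(k)})^{1/2}X. This yields … ∫dμ₀(X)G(Z₀, X, …)»*; the Jacobian `|det T|` cancels against the
normalisation. [cite: Balaban1988RG2Cluster, (2.6) pp.12–13] -/
theorem gaussMean_whiten (A T : Matrix Λ Λ ℝ) (hT : Tᵀ * A * T = 1) (Φ : (Λ → ℝ) → E) :
    gaussMean (1 : Matrix Λ Λ ℝ) (fun x => Φ (T *ᵥ x)) = gaussMean A Φ := by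
  have hne : T.det ≠ 0 := by
    have h := congrArg Matrix.det hT
    rw [det_mul, det_mul, det_transpose, det_one] at h
    intro h0
    rw [h0] at h
    simp at h
  have hdet : IsUnit T.det := isUnit_iff_ne_zero.mpr hne
  have hw : ∀ x : Λ → ℝ, gaussWeight 1 x = gaussWeight A (T *ᵥ x) := by
    intro x
    simp only [gaussWeight]
    rw [one_mulVec, mulVec_dotProduct_eq, mulVec_mulVec, mulVec_mulVec, hT, one_mulVec]
  have hI : gaussInt 1 (fun x => Φ (T *ᵥ x)) = |T.det|⁻¹ • gaussInt A Φ := by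
    unfold gaussInt
    simp_rw [hw]
    exact integral_comp_mulVec T hdet (fun x => gaussWeight A x • Φ x)
  have hN : gaussNorm (1 : Matrix Λ Λ ℝ) = |T.det|⁻¹ • gaussNorm A := by
    unfold gaussNorm
    simp_rw [hw]
    exact integral_comp_mulVec T hdet (fun x => gaussWeight A x)
  have hd : |T.det| ≠ 0 := abs_ne_zero.mpr hne
  rw [gaussMean, gaussMean, hI, hN, smul_eq_mul, smul_smul, mul_inv, inv_inv, mul_right_comm,
    mul_inv_cancel₀ hd, one_mul]

end GaussCond

end Literature.MathematicalPhysics.QuantumFieldTheory.Balaban1983to89.B13GaugeDevices
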